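import Literature.Geometry.Lorentzian.KerrDomainOfDependence
import Literature.Geometry.Lorentzian.KerrSchildKillingEnergy
import Literature.Geometry.Lorentzian.KerrSchildSlabDivergence
import Literature.Geometry.Lorentzian.KerrSurgeryBackgroundBounds
import HarnessLib

/-!
# Energy boundedness modulo integrated local energy on sub-extremal Kerr, with constants uniform in
# the rotation parameter (coordinate form, ingoing Kerr–Schild chart)

(family `gr`; namespaces `Literature.Geometry.Lorentzian.KerrSchild.Background` (pointwise algebra on
a generalised Kerr–Schild background) and `Literature.Geometry.Lorentzian.Kerr` (the estimate); proved
infrastructure for the linear-wave statements **gr.S24** and for the crux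
`PhaseMixingCapture.KappaExplicitWaveDecay` of the Final State Conjecture summit; no definitions and
no named facts are introduced)

Dafermos–Rodnianski (*Lectures on black holes and linear waves*, arXiv:0811.0354, §4.1 and §5.2)
and Dafermos–Rodnianski–Shlapentokh-Rothman (arXiv:1402.7034 = Ann. of Math. 183 (2016), §13, the
first reduction "boundedness follows from integrated local energy decay") bound the non-degenerate
energy of a solution `ψ` of `□_g ψ = 0` on a black-hole exterior through a later leaf by the initial
energy plus a space-time integral of `|∂ψ|²` over a *bounded* spatial region: the energy identity of a
vector field `N` equal to the Killing field `T = ∂_{t*}` far out (`K^T = 0`, and `T` is timelike off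
the ergoregion) and to a strictly timelike field near the hole, whose bulk `K^N` is supported in a
compact region of space and whose flux through the event horizon has a sign.

This file proves that estimate for the Kerr family in the ingoing Kerr–Schild chart, **with a constant
depending on the mass only** (uniform in `|a| < M`):

* `Kerr.exterior_coordEnergy_le_local` — for `M > 0` there is `C = C(M)` such that for every
  sub-extremal `a`, every `Φ : ℝ⁴ → ℝ` of class `C²` at the points of the exterior `{r > r₊}` solving
  the Kerr wave equation `∑_μ ∂_μ (g^{μν} ∂_ν Φ) = 0` there, whose derivative vanishes at the exterior
  points `(t, y)` with `0 ≤ t ≤ τ`, `‖y‖ > ρ₀` (spatially compact support on the slab, as provided by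
  finite speed of propagation), and every `τ ≥ 0`:
  `E(τ) ≤ C · (E(0) + ∫_{(0,τ]} E_loc(t, 3M) dt)` in `[0, ∞]`, where
  `E(t) = ∫_{{t* = t} ∩ {r > r₊}} ∑_μ (∂_μΦ)² dy` and `E_loc(t, R)` is the same integral over
  `{‖y‖ ≤ R}`.

## Proof

In the coefficient-field framework of `KerrSchild.waveOperator` on a generalised Kerr–Schild
background `B` (`g⁻¹ = η⁻¹ − φ ℓ♯ ⊗ ℓ♯`, `0 ≤ φ ≤ Φ_B`), the current is the **blended current**

  `C^μ = χ · (−(J^T)^μ) + (1 − χ) · P^μ`,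

`(J^T)^μ = T^μ{}_ν T^ν` the current of `T = ∂_0` (`KerrSchild.multiplierCurrent … timeField`, whose
negative time component is `KerrSchild.Background.tEnergyDensity`), `P^μ = T^{μ0}` the `dt`-current
(`KerrSchild.normalCurrent`) and `χ : ℝ⁴ → [0, 1]` a cutoff. Part 1 records its pointwise algebra on a
stationary background: `|(J^T)^μ|, |P^μ| ≲ (1 + Φ_B)² ∑ (∂w)²`; `C⁰ ≤ 3 (1 + Φ_B)² ∑ (∂w)²`;
`∑ (∂w)² ≤ 10 C⁰` wherever `χ ≠ 0 ⇒ φ ≤ 4/5`; the divergence identity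
`∑_μ ∂_μ C^μ = (□_G w)(…) − ∑_μ (∂_μ χ)((J^T)^μ + P^μ) + (1 − χ) R` (`K^T = 0` by stationarity,
`R = KerrSchild.deformationTerm`), and the bound `(48 L (1 + Φ_B)² + 32 (1 + Φ_B) D) ∑ (∂w)²` for the
bulk where `|∂χ| ≤ L`, `|∂g⁻¹| ≤ D`.

Part 2 runs the weighted slab argument of `Kerr.exterior_coordEnergy_le_exp`
(`KerrHorizonRegularWaveBoundednessProofs.lean`) on the surgered background
`Kerr.surgeryBackground M a r₊` with the cutoff `χ(x) = u_{11M/4, M/4}(‖x⃗‖)` (`radialTransition`, a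
function of `‖y‖` equal to `0` on `{‖y‖ ≤ 11M/4}` and to `1` on `{‖y‖ ≥ 3M}`): on the support of `χ`
one has `r > 5M/2`, hence `2H ≤ 2M/r ≤ 4/5` uniformly in `a`; the bulk of `C` is supported in
`{‖y‖ ≤ 3M}` and bounded by `C_K(M) ∑ (∂Φ)²` (the explicit bound `Kerr.surgeryDerivBound` of
`KerrSurgeryBackgroundBounds.lean`, estimated uniformly on `|a| ≤ M`, `r₀ = r₊ ∈ [M, 2M]`). The
horizon is handled by the receding weight `W_ε = σ(u₂/ε − 1)`, `u₂ = (r − r₊) e^{−t*/(2M)}`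
(`Kerr.horizonFn`): its differential is a past causal covector and the flux term
`∑ (∂_μ W_ε) C^μ = ∑ (∂_μ W_ε) P^μ ≤ 0` has a sign by the dominant energy condition
(`Kerr.horizonFactor_flux`; the layer `{dW_ε ≠ 0}` lies in `{χ = 0}` for `ε ≤ (M/4) e^{−τ/(2M)}`).
The divergence identity on the slab (`E4.ballIntegral_sub_eq_integral_divergence`) gives
`∫ W_ε C⁰(τ) ≤ ∫ W_ε C⁰(0) + C_K ∫_0^τ E_loc(t, 3M) dt`, and `ε → 0` with monotone convergence
concludes. No regularity of `Φ` at the horizon is used.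

## References

* M. Dafermos, I. Rodnianski, *Lectures on black holes and linear waves*, arXiv:0811.0354, §4.1,
  §5.2, App. D (key `DafermosRodnianski2008`).
* M. Dafermos, I. Rodnianski, Y. Shlapentokh-Rothman, arXiv:1402.7034 = Ann. of Math. 183 (2016),
  §13 (first reduction), §2.2.2, §2.2.4, §2.3.2 (key `DafermosRodnianskiShlapentokhrothman2014`).
* S. W. Hawking, G. F. R. Ellis, *The large scale structure of space-time*, CUP 1973, §4.3,
  Lemma 4.3.1 (key `HawkingEllis1973CUP`).
* R. P. Kerr, A. Schild, 1965, §2 (key `KerrSchild1965`).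
-/

noncomputable section

open Set Filter Metric MeasureTheory
open scoped Topology ContDiff ENNReal

namespace Literature.Geometry.Lorentzian

/-! ## Part 1. The blended current on a generalised Kerr–Schild background -/

namespace KerrSchild

namespace Background

variable (B : Background)

/-! ### The size of the `T`-current -/

/-- **`|(J^T)^μ| ≤ 6 (1 + Φ) ∑_κ (∂_κ w)²`** for every component of the `∂_0`-current on a
background (`(J^T)^μ = A^μ ∂_0 w − ½ δ^μ_0 Q`, `|g^{μν}| ≤ 1 + Φ`, `(∑|p|)² ≤ 4 ∑ p²`). [folklore] -/
theorem abs_timeCurrent_le (w : E4 → ℝ) (x : E4) (μ : Fin 4) :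
    |multiplierCurrent B.inverseMetric timeField w x μ| ≤
      6 * (1 + B.bound) * ∑ κ, fderiv ℝ w x (E4.basisVector κ) ^ 2 := by
  set p : Fin 4 → ℝ := fun κ ↦ fderiv ℝ w x (E4.basisVector κ) with hp
  set S : ℝ := ∑ κ, p κ ^ 2 with hS
  set Tt : ℝ := ∑ κ, |p κ| with hT
  have hΦ0 : 0 ≤ B.bound := (B.φ_nonneg x).trans (B.φ_le x)
  have hA : ∀ α β, |B.inverseMetric x α β| ≤ 1 + B.bound := B.abs_inverseMetric_le x
  have hT0 : 0 ≤ Tt := Finset.sum_nonneg fun _ _ ↦ abs_nonneg _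
  have hsq : Tt ^ 2 ≤ 4 * S := Kerr.sq_sum_abs_le_four_mul p
  have h1 : ∀ α, |∑ ν, B.inverseMetric x α ν * p ν| ≤ (1 + B.bound) * Tt := by
    intro α
    calc _ ≤ ∑ ν, |B.inverseMetric x α ν * p ν| := Finset.abs_sum_le_sum_abs _ _
      _ ≤ ∑ ν, (1 + B.bound) * |p ν| := Finset.sum_le_sum fun ν _ ↦ by
          rw [abs_mul]; exact mul_le_mul_of_nonneg_right (hA α ν) (abs_nonneg _)
      _ = (1 + B.bound) * Tt := by rw [hT, Finset.mul_sum]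
  have h2 : |∑ α, ∑ β, B.inverseMetric x α β * p α * p β| ≤ (1 + B.bound) * Tt * Tt :=
    Kerr.abs_sum_sum_mul_mul_le _ p p hA
  have hp0 : |p 0| ≤ Tt :=
    Finset.single_le_sum (f := fun κ ↦ |p κ|) (fun _ _ ↦ abs_nonneg _) (Finset.mem_univ 0)
  have hTμ : |timeField x μ| ≤ 1 := by
    unfold timeField
    split_ifs <;> simp
  have hJ : multiplierCurrent B.inverseMetric timeField w x μ =
      (∑ ν, B.inverseMetric x μ ν * p ν) * p 0 -
        2⁻¹ * timeField x μ * ∑ α, ∑ β, B.inverseMetric x α β * p α * p β := by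
    simp only [multiplierCurrent, sum_timeField_mul, hp]
  rw [hJ]
  calc |(∑ ν, B.inverseMetric x μ ν * p ν) * p 0 -
        2⁻¹ * timeField x μ * ∑ α, ∑ β, B.inverseMetric x α β * p α * p β|
      ≤ |(∑ ν, B.inverseMetric x μ ν * p ν) * p 0| +
          |2⁻¹ * timeField x μ * ∑ α, ∑ β, B.inverseMetric x α β * p α * p β| := abs_sub _ _
    _ ≤ (1 + B.bound) * Tt * Tt + 2⁻¹ * 1 * ((1 + B.bound) * Tt * Tt) := by
        refine add_le_add ?_ ?_
        · rw [abs_mul]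
          exact mul_le_mul (h1 μ) hp0 (abs_nonneg _) (by positivity)
        · rw [abs_mul, abs_mul, abs_of_pos (by norm_num : (0 : ℝ) < 2⁻¹)]
          exact mul_le_mul (mul_le_mul_of_nonneg_left hTμ (by norm_num)) h2 (abs_nonneg _)
            (by positivity)
    _ = 3 / 2 * (1 + B.bound) * Tt ^ 2 := by ring
    _ ≤ 3 / 2 * (1 + B.bound) * (4 * S) := by gcongr
    _ = 6 * (1 + B.bound) * S := by ring

/-- **`|(J^T)^μ + P^μ| ≤ 12 (1 + Φ)² ∑_κ (∂_κ w)²`**: the sum of the `T`-current and the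
`dt`-current (the coefficient of `∂χ` in the bulk of the blended current) is quadratic in `∂w` with
coefficient `12 (1 + Φ)²` (`|P^μ| ≤ 6 (1 + Φ)² ∑ p²` as for the `T`-current, with one more factor
`1 + Φ` from `X = ∑ g^{0α} p_α`). [folklore] -/
theorem abs_timeCurrent_add_normalCurrent_le (w : E4 → ℝ) (x : E4) (μ : Fin 4) :
    |multiplierCurrent B.inverseMetric timeField w x μ + normalCurrent B.inverseMetric w x μ| ≤
      12 * (1 + B.bound) ^ 2 * ∑ κ, fderiv ℝ w x (E4.basisVector κ) ^ 2 := by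
  have hTb := B.abs_timeCurrent_le w x μ
  suffices hP : |normalCurrent B.inverseMetric w x μ| ≤
      6 * (1 + B.bound) ^ 2 * ∑ κ, fderiv ℝ w x (E4.basisVector κ) ^ 2 by
    have hΦ0 : 0 ≤ B.bound := (B.φ_nonneg x).trans (B.φ_le x)
    have hS0 : 0 ≤ ∑ κ, fderiv ℝ w x (E4.basisVector κ) ^ 2 := Finset.sum_nonneg fun _ _ ↦ sq_nonneg _
    calc _ ≤ |multiplierCurrent B.inverseMetric timeField w x μ| + |normalCurrent B.inverseMetric w x μ| :=
          abs_add_le _ _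
      _ ≤ 6 * (1 + B.bound) * ∑ κ, fderiv ℝ w x (E4.basisVector κ) ^ 2 +
            6 * (1 + B.bound) ^ 2 * ∑ κ, fderiv ℝ w x (E4.basisVector κ) ^ 2 := add_le_add hTb hP
      _ ≤ _ := by nlinarith [mul_nonneg hΦ0 hS0, mul_nonneg (mul_nonneg hΦ0 hΦ0) hS0]
  set p : Fin 4 → ℝ := fun κ ↦ fderiv ℝ w x (E4.basisVector κ) with hp
  set S : ℝ := ∑ κ, p κ ^ 2 with hS
  set Tt : ℝ := ∑ κ, |p κ| with hT
  have hΦ0 : 0 ≤ B.bound := (B.φ_nonneg x).trans (B.φ_le x)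
  have hA : ∀ α β, |B.inverseMetric x α β| ≤ 1 + B.bound := B.abs_inverseMetric_le x
  have hT0 : 0 ≤ Tt := Finset.sum_nonneg fun _ _ ↦ abs_nonneg _
  have hsq : Tt ^ 2 ≤ 4 * S := Kerr.sq_sum_abs_le_four_mul p
  have h1 : ∀ α, |∑ ν, B.inverseMetric x α ν * p ν| ≤ (1 + B.bound) * Tt := by
    intro α
    calc _ ≤ ∑ ν, |B.inverseMetric x α ν * p ν| := Finset.abs_sum_le_sum_abs _ _
      _ ≤ ∑ ν, (1 + B.bound) * |p ν| := Finset.sum_le_sum fun ν _ ↦ by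
          rw [abs_mul]; exact mul_le_mul_of_nonneg_right (hA α ν) (abs_nonneg _)
      _ = (1 + B.bound) * Tt := by rw [hT, Finset.mul_sum]
  have h2 : |∑ α, ∑ β, B.inverseMetric x α β * p α * p β| ≤ (1 + B.bound) * Tt * Tt :=
    Kerr.abs_sum_sum_mul_mul_le _ p p hA
  have hP : normalCurrent B.inverseMetric w x μ =
      (∑ ν, B.inverseMetric x μ ν * p ν) * (∑ α, B.inverseMetric x 0 α * p α) -
        2⁻¹ * B.inverseMetric x 0 μ * ∑ α, ∑ β, B.inverseMetric x α β * p α * p β := rfl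
  rw [hP]
  calc |(∑ ν, B.inverseMetric x μ ν * p ν) * (∑ α, B.inverseMetric x 0 α * p α) -
        2⁻¹ * B.inverseMetric x 0 μ * ∑ α, ∑ β, B.inverseMetric x α β * p α * p β|
      ≤ |(∑ ν, B.inverseMetric x μ ν * p ν) * (∑ α, B.inverseMetric x 0 α * p α)| +
          |2⁻¹ * B.inverseMetric x 0 μ * ∑ α, ∑ β, B.inverseMetric x α β * p α * p β| :=
        abs_sub _ _
    _ ≤ (1 + B.bound) * Tt * ((1 + B.bound) * Tt) +
          2⁻¹ * (1 + B.bound) * ((1 + B.bound) * Tt * Tt) := by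
        refine add_le_add ?_ ?_
        · rw [abs_mul]
          exact mul_le_mul (h1 μ) (h1 0) (abs_nonneg _) (by positivity)
        · rw [abs_mul, abs_mul, abs_of_pos (by norm_num : (0 : ℝ) < 2⁻¹)]
          exact mul_le_mul (mul_le_mul_of_nonneg_left (hA 0 μ) (by norm_num)) h2
            (abs_nonneg _) (by positivity)
    _ = 3 / 2 * (1 + B.bound) ^ 2 * Tt ^ 2 := by ring
    _ ≤ 3 / 2 * (1 + B.bound) ^ 2 * (4 * S) := by gcongr
    _ = 6 * (1 + B.bound) ^ 2 * S := by ring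


/-! ### The blended current `χ (−J^T) + (1 − χ) P`: density bounds -/

/-- **Upper bound for the blended energy density**: for `0 ≤ χ(x) ≤ 1`,
`χ (−(J^T)⁰) + (1 − χ) P⁰ ≤ 3 (1 + Φ)² ∑_μ (∂_μ w)²` (`e ≤ ½ (1 + Φ) ∑ p²`, `P⁰ ≤ 3 (1 + Φ)² ∑ p²`).
[folklore] -/
theorem blendCurrent_zero_le {χ : E4 → ℝ} (w : E4 → ℝ) {x : E4} (h0 : 0 ≤ χ x) (h1 : χ x ≤ 1) :
    χ x * (-multiplierCurrent B.inverseMetric timeField w x 0) +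
        (1 - χ x) * normalCurrent B.inverseMetric w x 0 ≤
      3 * (1 + B.bound) ^ 2 * ∑ μ, fderiv ℝ w x (E4.basisVector μ) ^ 2 := by
  have hΦ0 : 0 ≤ B.bound := (B.φ_nonneg x).trans (B.φ_le x)
  set S := ∑ μ, fderiv ℝ w x (E4.basisVector μ) ^ 2 with hS
  have hS0 : 0 ≤ S := Finset.sum_nonneg fun _ _ ↦ sq_nonneg _
  have he : -multiplierCurrent B.inverseMetric timeField w x 0 ≤ 3 * (1 + B.bound) ^ 2 * S := by
    have h := B.tEnergyDensity_le' w x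
    rw [tEnergyDensity] at h
    refine h.trans ?_
    nlinarith [mul_nonneg hΦ0 hS0, mul_nonneg (mul_nonneg hΦ0 hΦ0) hS0]
  have hP : normalCurrent B.inverseMetric w x 0 ≤ 3 * (1 + B.bound) ^ 2 * S :=
    B.normalCurrent_zero_le w x
  nlinarith [mul_le_mul_of_nonneg_left he h0, mul_le_mul_of_nonneg_left hP (sub_nonneg.2 h1)]

/-- **Coercivity of the blended energy density**: if `φ ≤ 4/5` wherever `χ ≠ 0` (the cutoff is
supported off the ergoregion with margin) and `0 ≤ χ ≤ 1`, then
`∑_μ (∂_μ w)² ≤ 10 (χ (−(J^T)⁰) + (1 − χ) P⁰)` (`e ≥ ½ (1 − φ) ∑ p² ≥ ∑ p²/10`, `∑ p² ≤ 6 P⁰`).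
Dafermos–Rodnianski arXiv:0811.0354, §4.1 (`J^N_μ n^μ ∼ ∑ (∂ψ)²` for strictly timelike `N`).
[cite: DafermosRodnianski2008, §4.1] -/
theorem le_blendCurrent_zero {χ : E4 → ℝ} (w : E4 → ℝ) {x : E4} (h0 : 0 ≤ χ x) (h1 : χ x ≤ 1)
    (hφ : χ x ≠ 0 → B.φ x ≤ 4 / 5) :
    ∑ μ, fderiv ℝ w x (E4.basisVector μ) ^ 2 ≤
      10 * (χ x * (-multiplierCurrent B.inverseMetric timeField w x 0) +
        (1 - χ x) * normalCurrent B.inverseMetric w x 0) := by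
  set S := ∑ μ, fderiv ℝ w x (E4.basisVector μ) ^ 2 with hS
  have hS0 : 0 ≤ S := Finset.sum_nonneg fun _ _ ↦ sq_nonneg _
  have hP : S ≤ 6 * normalCurrent B.inverseMetric w x 0 :=
    B.sum_sq_le_six_mul_normalCurrent_zero w x
  by_cases hχ : χ x = 0
  · rw [hχ]; nlinarith
  · have hφx := hφ hχ
    have he : S ≤ 10 * -multiplierCurrent B.inverseMetric timeField w x 0 := by
      have h := B.tEnergyDensity_ge w x
      rw [tEnergyDensity] at h
      nlinarith
    nlinarith [mul_le_mul_of_nonneg_left he h0, mul_le_mul_of_nonneg_left hP (sub_nonneg.2 h1)]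

/-! ### Regularity and the divergence identity -/

/-- The `T`-current of a function `C²` at `x` is `C¹` at `x`. [folklore] -/
theorem contDiffAt_timeCurrent {w : E4 → ℝ} {x : E4} (hw : ContDiffAt ℝ 2 w x) (μ : Fin 4) :
    ContDiffAt ℝ 1 (fun y ↦ multiplierCurrent B.inverseMetric timeField w y μ) x := by
  have h2 : ContDiffAt ℝ ((1 : ℕ∞) + 1 : ℕ∞) w x := by exact_mod_cast hw
  have hp : ∀ ν, ContDiffAt ℝ 1 (fun y ↦ fderiv ℝ w y (E4.basisVector ν)) x := fun ν ↦
    (h2.fderiv_right (m := 1) le_rfl).clm_apply contDiffAt_const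
  have hg : ∀ α β, ContDiffAt ℝ 1 (fun y ↦ B.inverseMetric y α β) x := fun α β ↦
    (B.contDiff_one_inverseMetric α β).contDiffAt
  unfold multiplierCurrent
  exact ((ContDiffAt.sum fun ν _ ↦ (hg μ ν).mul (hp ν)).mul
    (ContDiffAt.sum fun α _ ↦ (contDiff_timeField α).contDiffAt.mul (hp α))).sub
    ((contDiffAt_const.mul (contDiff_timeField μ).contDiffAt).mul
      (ContDiffAt.sum fun α _ ↦ ContDiffAt.sum fun β _ ↦ ((hg α β).mul (hp α)).mul (hp β)))

/-- The blended current of a `C¹` cutoff and a function `C²` at `x` is `C¹` at `x`. [folklore] -/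
theorem contDiffAt_blendCurrent {χ w : E4 → ℝ} {x : E4} (hχ : ContDiff ℝ 1 χ)
    (hw : ContDiffAt ℝ 2 w x) (μ : Fin 4) :
    ContDiffAt ℝ 1 (fun y ↦ χ y * (-multiplierCurrent B.inverseMetric timeField w y μ) +
      (1 - χ y) * normalCurrent B.inverseMetric w y μ) x :=
  (hχ.contDiffAt.mul (B.contDiffAt_timeCurrent hw μ).neg).add
    ((contDiffAt_const.sub hχ.contDiffAt).mul (B.contDiffAt_normalCurrent hw μ))

/-- **The divergence of the blended current on a stationary background.** If `∂_0 g^{αβ} = 0`,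
`χ ∈ C¹` and `w` is `C²` at `x`, then
`∑_μ ∂_μ C^μ = (□_G w)(−χ ∂_0 w + (1 − χ) ∑_α g^{0α} ∂_α w) + blendBulk`
(`∑ ∂_μ (J^T)^μ = (□_G w) ∂_0 w` by `K^T = 0`, `∑ ∂_μ P^μ = (□_G w) g^{0α}∂_α w + R`, Leibniz).
Dafermos–Rodnianski arXiv:0811.0354, App. D; DRSR arXiv:1402.7034, §2.3.2.
[cite: DafermosRodnianski2008, App. D] -/
theorem sum_fderiv_blendCurrent
    (hstat : ∀ y α β, fderiv ℝ (fun z ↦ B.inverseMetric z α β) y (E4.basisVector 0) = 0)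
    {χ w : E4 → ℝ} {x : E4} (hχ : ContDiff ℝ 1 χ) (hw : ContDiffAt ℝ 2 w x) :
    ∑ μ, fderiv ℝ (fun y ↦ χ y * (-multiplierCurrent B.inverseMetric timeField w y μ) +
        (1 - χ y) * normalCurrent B.inverseMetric w y μ) x (E4.basisVector μ) =
      waveOperator B.inverseMetric w x *
          (-(χ x * fderiv ℝ w x (E4.basisVector 0)) +
            (1 - χ x) * ∑ α, B.inverseMetric x 0 α * fderiv ℝ w x (E4.basisVector α)) +
        (-(∑ μ, fderiv ℝ χ x (E4.basisVector μ) *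
            (multiplierCurrent B.inverseMetric timeField w x μ +
              normalCurrent B.inverseMetric w x μ)) +
          (1 - χ x) * deformationTerm B.inverseMetric w x) := by
  -- the two divergence identities
  have hG : ∀ μ ν, DifferentiableAt ℝ (fun y ↦ B.inverseMetric y μ ν) x :=
    fun μ ν ↦ B.differentiableAt_inverseMetric x μ ν
  have hdivT : ∑ μ, fderiv ℝ (fun y ↦ multiplierCurrent B.inverseMetric timeField w y μ) x
      (E4.basisVector μ) = waveOperator B.inverseMetric w x * fderiv ℝ w x (E4.basisVector 0) := by
    rw [sum_fderiv_multiplierCurrent hG (B.inverseMetric_symm x)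
      (fun α ↦ (contDiff_timeField α).contDiffAt.differentiableAt one_ne_zero) hw,
      sum_timeField_mul, B.multiplierBulk_timeField_eq_zero hstat, add_zero]
  have hdivP := sum_fderiv_normalCurrent hG (B.inverseMetric_symm x) hw
  -- differentiability of the pieces
  have hχd : DifferentiableAt ℝ χ x := hχ.contDiffAt.differentiableAt one_ne_zero
  have hTd : ∀ μ, DifferentiableAt ℝ
      (fun y ↦ multiplierCurrent B.inverseMetric timeField w y μ) x := fun μ ↦
    (B.contDiffAt_timeCurrent hw μ).differentiableAt one_ne_zero
  have hPd : ∀ μ, DifferentiableAt ℝ (fun y ↦ normalCurrent B.inverseMetric w y μ) x := fun μ ↦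
    (B.contDiffAt_normalCurrent hw μ).differentiableAt one_ne_zero
  -- Leibniz
  have hprod : ∀ μ, fderiv ℝ (fun y ↦ χ y * (-multiplierCurrent B.inverseMetric timeField w y μ) +
      (1 - χ y) * normalCurrent B.inverseMetric w y μ) x (E4.basisVector μ) =
      fderiv ℝ χ x (E4.basisVector μ) * (-multiplierCurrent B.inverseMetric timeField w x μ) +
        χ x * (-fderiv ℝ (fun y ↦ multiplierCurrent B.inverseMetric timeField w y μ) x
          (E4.basisVector μ)) +
        (-(fderiv ℝ χ x (E4.basisVector μ)) * normalCurrent B.inverseMetric w x μ +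
          (1 - χ x) * fderiv ℝ (fun y ↦ normalCurrent B.inverseMetric w y μ) x
            (E4.basisVector μ)) := by
    intro μ
    have h1 : HasFDerivAt (fun y ↦ χ y * (-multiplierCurrent B.inverseMetric timeField w y μ))
        (χ x • (-fderiv ℝ (fun y ↦ multiplierCurrent B.inverseMetric timeField w y μ) x) +
          (-multiplierCurrent B.inverseMetric timeField w x μ) • fderiv ℝ χ x) x :=
      hχd.hasFDerivAt.mul (hTd μ).hasFDerivAt.neg
    have h2' : HasFDerivAt (fun y ↦ (1 - χ y) * normalCurrent B.inverseMetric w y μ)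
        ((1 - χ x) • fderiv ℝ (fun y ↦ normalCurrent B.inverseMetric w y μ) x +
          normalCurrent B.inverseMetric w x μ • (0 - fderiv ℝ χ x)) x :=
      ((hasFDerivAt_const (1 : ℝ) x).sub hχd.hasFDerivAt).mul (hPd μ).hasFDerivAt
    have h : HasFDerivAt (fun y ↦ χ y * (-multiplierCurrent B.inverseMetric timeField w y μ) +
        (1 - χ y) * normalCurrent B.inverseMetric w y μ)
        (χ x • (-fderiv ℝ (fun y ↦ multiplierCurrent B.inverseMetric timeField w y μ) x) +
          (-multiplierCurrent B.inverseMetric timeField w x μ) • fderiv ℝ χ x +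
          ((1 - χ x) • fderiv ℝ (fun y ↦ normalCurrent B.inverseMetric w y μ) x +
            normalCurrent B.inverseMetric w x μ • (0 - fderiv ℝ χ x))) x :=
      h1.add h2'
    rw [h.fderiv]
    simp only [add_apply, FunLike.coe_smul, Pi.smul_apply, neg_apply, smul_eq_mul,
      FunLike.coe_sub, Pi.sub_apply, zero_apply]
    ring
  simp only [hprod, Finset.sum_add_distrib]
  have hA : ∑ μ, χ x * -fderiv ℝ (fun y ↦ multiplierCurrent B.inverseMetric timeField w y μ) x
      (E4.basisVector μ) = -(χ x * (waveOperator B.inverseMetric w x *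
        fderiv ℝ w x (E4.basisVector 0))) := by
    rw [← hdivT, Finset.mul_sum, ← Finset.sum_neg_distrib]
    exact Finset.sum_congr rfl fun μ _ ↦ by ring
  have hB' : ∑ μ, (1 - χ x) * fderiv ℝ (fun y ↦ normalCurrent B.inverseMetric w y μ) x
      (E4.basisVector μ) = (1 - χ x) * (waveOperator B.inverseMetric w x *
        (∑ α, B.inverseMetric x 0 α * fderiv ℝ w x (E4.basisVector α)) +
          deformationTerm B.inverseMetric w x) := by
    rw [← hdivP, Finset.mul_sum]
  have hAC : (∑ μ, fderiv ℝ χ x (E4.basisVector μ) *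
        (-multiplierCurrent B.inverseMetric timeField w x μ)) +
      ∑ μ, -(fderiv ℝ χ x (E4.basisVector μ)) * normalCurrent B.inverseMetric w x μ =
      -(∑ μ, fderiv ℝ χ x (E4.basisVector μ) *
        (multiplierCurrent B.inverseMetric timeField w x μ +
          normalCurrent B.inverseMetric w x μ)) := by
    rw [← Finset.sum_add_distrib, ← Finset.sum_neg_distrib]
    exact Finset.sum_congr rfl fun μ _ ↦ by ring
  rw [hA, hB']
  linear_combination hAC

/-- **Bound for the blended bulk**: if `|∂_μ χ| ≤ L` and `|∂_μ g^{αβ}| ≤ D` at `x` and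
`0 ≤ χ(x) ≤ 1`, then `|blendBulk| ≤ (48 L (1 + Φ)² + 32 (1 + Φ) D) ∑_μ (∂_μ w)²`
(`|(J^T)^μ| ≤ 6 (1 + Φ) ∑p²`, `|P^μ| ≤ 6 (1 + Φ)² ∑p²`, `|R| ≤ 32 (1 + Φ) D ∑p²`). The bulk of an
interpolating multiplier is quadratic in `∂w` with bounded coefficients (Dafermos–Rodnianski
arXiv:0811.0354, §4.1: `|K^N| ≤ B |∂ψ|²` on the interpolation region). [cite: DafermosRodnianski2008, §4.1] -/
theorem abs_blendBulk_le {χ : E4 → ℝ} (w : E4 → ℝ) {x : E4} {L D : ℝ} (hL0 : 0 ≤ L) (hD0 : 0 ≤ D)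
    (hL : ∀ μ, |fderiv ℝ χ x (E4.basisVector μ)| ≤ L) (h0 : 0 ≤ χ x) (h1 : χ x ≤ 1)
    (hD : ∀ μ α β, |fderiv ℝ (fun y ↦ B.inverseMetric y α β) x (E4.basisVector μ)| ≤ D) :
    |-(∑ μ, fderiv ℝ χ x (E4.basisVector μ) *
          (multiplierCurrent B.inverseMetric timeField w x μ + normalCurrent B.inverseMetric w x μ)) +
        (1 - χ x) * deformationTerm B.inverseMetric w x| ≤
      (48 * L * (1 + B.bound) ^ 2 + 32 * (1 + B.bound) * D) *
        ∑ μ, fderiv ℝ w x (E4.basisVector μ) ^ 2 := by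
  set S := ∑ μ, fderiv ℝ w x (E4.basisVector μ) ^ 2 with hS
  have hS0 : 0 ≤ S := Finset.sum_nonneg fun _ _ ↦ sq_nonneg _
  have hΦ0 : 0 ≤ B.bound := (B.φ_nonneg x).trans (B.φ_le x)
  have hTP : ∀ μ, |multiplierCurrent B.inverseMetric timeField w x μ +
      normalCurrent B.inverseMetric w x μ| ≤ 12 * (1 + B.bound) ^ 2 * S := fun μ ↦
    B.abs_timeCurrent_add_normalCurrent_le w x μ
  have hR : |deformationTerm B.inverseMetric w x| ≤ 32 * (1 + B.bound) * D * S :=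
    B.abs_deformationTerm_le w x hD0 hD
  have hsum : |∑ μ, fderiv ℝ χ x (E4.basisVector μ) *
      (multiplierCurrent B.inverseMetric timeField w x μ + normalCurrent B.inverseMetric w x μ)| ≤
      4 * (L * (12 * (1 + B.bound) ^ 2 * S)) := by
    calc _ ≤ ∑ μ, |fderiv ℝ χ x (E4.basisVector μ) *
          (multiplierCurrent B.inverseMetric timeField w x μ +
            normalCurrent B.inverseMetric w x μ)| := Finset.abs_sum_le_sum_abs _ _
      _ ≤ ∑ _μ : Fin 4, L * (12 * (1 + B.bound) ^ 2 * S) := by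
          refine Finset.sum_le_sum fun μ _ ↦ ?_
          rw [abs_mul]
          exact mul_le_mul (hL μ) (hTP μ) (abs_nonneg _) hL0
      _ = 4 * (L * (12 * (1 + B.bound) ^ 2 * S)) := by simp
  have h1χ : |1 - χ x| ≤ 1 := by
    rw [abs_of_nonneg (sub_nonneg.2 h1)]; linarith
  calc _ ≤ |-(∑ μ, fderiv ℝ χ x (E4.basisVector μ) *
          (multiplierCurrent B.inverseMetric timeField w x μ +
            normalCurrent B.inverseMetric w x μ))| +
        |(1 - χ x) * deformationTerm B.inverseMetric w x| := abs_add_le _ _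
    _ ≤ 4 * (L * (12 * (1 + B.bound) ^ 2 * S)) + 1 * (32 * (1 + B.bound) * D * S) := by
        rw [abs_neg, abs_mul]
        exact add_le_add hsum (mul_le_mul h1χ hR (abs_nonneg _) zero_le_one)
    _ = (48 * L * (1 + B.bound) ^ 2 + 32 * (1 + B.bound) * D) * S := by ring

end Background

end KerrSchild

/-! ## Part 2. The estimate on the Kerr exterior -/

namespace Kerr

/-! ### The far cutoff `χ_M(x) = u_{11M/4, M/4}(x⃗)` (`radialTransition` of the spatial part) -/

/-- `χ_M = 0` on `{‖x⃗‖ ≤ 11M/4}` (`M > 0`). [folklore] -/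
theorem farCutoff_eq_zero {M : ℝ} (hM : 0 < M) {x : E4} (hx : E4.spatialNorm x ≤ 11 * M / 4) :
    radialTransition (11 * M / 4) (M / 4) (E4.spatial x) = 0 :=
  radialTransition_of_norm_le (by positivity) hx

/-- `χ_M = 1` on `{‖x⃗‖ ≥ 3M}` (`M > 0`). [folklore] -/
theorem farCutoff_eq_one {M : ℝ} (hM : 0 < M) {x : E4} (hx : 3 * M ≤ E4.spatialNorm x) :
    radialTransition (11 * M / 4) (M / 4) (E4.spatial x) = 1 :=
  radialTransition_of_le_norm (by positivity) (by unfold E4.spatialNorm at hx; linarith)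

/-- Where `χ_M ≠ 0`, `‖x⃗‖ > 11M/4`. [folklore] -/
theorem lt_spatialNorm_of_farCutoff_ne_zero {M : ℝ} (hM : 0 < M) {x : E4} (hx : radialTransition (11 * M / 4) (M / 4) (E4.spatial x) ≠ 0) :
    11 * M / 4 < E4.spatialNorm x := by
  by_contra h
  exact hx (farCutoff_eq_zero hM (not_lt.mp h))

/-- The far cutoff is `C^n` (`M > 0`). [folklore] -/
theorem contDiff_farCutoff {M : ℝ} (hM : 0 < M) {n : ℕ∞} : ContDiff ℝ n (fun x : E4 ↦ radialTransition (11 * M / 4) (M / 4) (E4.spatial x)) :=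
  (contDiff_radialTransition (by positivity) (by positivity)).comp E4.spatial.contDiff

/-- On the open set `{‖x⃗‖ > 3M}` the far cutoff is locally constant, so its derivative vanishes.
[folklore] -/
theorem fderiv_farCutoff_eq_zero {M : ℝ} (hM : 0 < M) {x : E4} (hx : 3 * M < E4.spatialNorm x) :
    fderiv ℝ (fun x : E4 ↦ radialTransition (11 * M / 4) (M / 4) (E4.spatial x)) x = 0 := by
  have hev : (fun x : E4 ↦ radialTransition (11 * M / 4) (M / 4) (E4.spatial x)) =ᶠ[𝓝 x]
      fun _ ↦ (1 : ℝ) := by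
    have hO : IsOpen {y : E4 | 3 * M < E4.spatialNorm y} :=
      isOpen_lt continuous_const E4.continuous_spatialNorm
    filter_upwards [hO.mem_nhds hx] with y hy
    exact farCutoff_eq_one hM hy.le
  rw [hev.fderiv_eq, fderiv_const_apply]

/-- **Slope of the far cutoff**: `|∂_μ χ_M| ≤ K/(M/4)` where `K` bounds `|σ'|`
(`‖x⃗(∂_μ)‖ ≤ 1`). [folklore] -/
theorem abs_fderiv_farCutoff_le {M K : ℝ} (hM : 0 < M) (hK : ∀ t, |deriv Real.smoothTransition t| ≤ K)
    (x : E4) (μ : Fin 4) :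
    |fderiv ℝ (fun x : E4 ↦ radialTransition (11 * M / 4) (M / 4) (E4.spatial x)) x
      (E4.basisVector μ)| ≤ K / (M / 4) := by
  have hK0 : 0 ≤ K := (abs_nonneg _).trans (hK 0)
  have hc : (0 : ℝ) < 11 * M / 4 := by positivity
  have hL : (0 : ℝ) < M / 4 := by positivity
  have hd : HasFDerivAt (fun x : E4 ↦ radialTransition (11 * M / 4) (M / 4) (E4.spatial x))
      ((fderiv ℝ (radialTransition (11 * M / 4) (M / 4)) (E4.spatial x)).comp E4.spatial) x :=
    (((contDiff_radialTransition hc hL (n := 1)).differentiable one_ne_zero) _).hasFDerivAt.comp x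
      E4.spatial.hasFDerivAt
  rw [hd.fderiv, ContinuousLinearMap.comp_apply]
  have hsp : ‖E4.spatial (E4.basisVector μ)‖ ≤ 1 := by
    have hle : E4.spatialNorm (E4.basisVector μ) ^ 2 ≤ 1 := by
      rw [E4.spatialNorm_sq]
      fin_cases μ <;> simp [E4.basisVector]
    have h0 : 0 ≤ E4.spatialNorm (E4.basisVector μ) := E4.spatialNorm_nonneg _
    show E4.spatialNorm (E4.basisVector μ) ≤ 1
    nlinarith
  calc _ = ‖fderiv ℝ (radialTransition (11 * M / 4) (M / 4)) (E4.spatial x) (E4.spatial (E4.basisVector μ))‖ :=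
        (Real.norm_eq_abs _).symm
    _ ≤ ‖fderiv ℝ (radialTransition (11 * M / 4) (M / 4)) (E4.spatial x)‖ *
          ‖E4.spatial (E4.basisVector μ)‖ := ContinuousLinearMap.le_opNorm _ _
    _ ≤ K / (M / 4) * 1 :=
        mul_le_mul (norm_fderiv_radialTransition_le hc hL hK _) hsp (norm_nonneg _) (by positivity)
    _ = K / (M / 4) := mul_one _

/-! ### Geometry of the support of the cutoff, uniformly in `|a| < M` -/

/-- **Off `{‖x⃗‖ ≤ 11M/4}` one is well outside the ergoregion and the horizon, uniformly in
`|a| < M`**: `r > 5M/2` and `r > r₊ + M/2` (`r² ≥ ‖x⃗‖² − a² > (121/16 − 1) M² > (5M/2)²`,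
`r₊ ≤ 2M`). [folklore] -/
theorem radius_gt_of_lt_spatialNorm {M a : ℝ} (hMa : IsSubextremal M a) {x : E4}
    (hx : 11 * M / 4 < E4.spatialNorm x) :
    5 * M / 2 < radius a x ∧ rPlus M a + M / 2 < radius a x := by
  have hM : 0 < M := hMa.pos
  have ha : a ^ 2 < M ^ 2 := sq_lt_sq' (abs_lt.1 hMa).1 (abs_lt.1 hMa).2
  have h1 := spatialNorm_sq_sub_sq_le_radius_sq a x
  have hsn : 0 ≤ E4.spatialNorm x := E4.spatialNorm_nonneg x
  have h2 : (11 * M / 4) ^ 2 < E4.spatialNorm x ^ 2 := by nlinarith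
  have hr2 : (5 * M / 2) ^ 2 < radius a x ^ 2 := by nlinarith
  have hr0 := radius_nonneg a x
  have hr : 5 * M / 2 < radius a x := by nlinarith
  exact ⟨hr, by linarith [rPlus_le_two_mul (a := a) hM.le]⟩

/-- **On the support of the far cutoff the Kerr–Schild profile is at most `4/5`**: for an exterior
point `x` with `χ_M(x) ≠ 0` and `|a| < M`, `2H(x) ≤ 2M/r ≤ 4/5` (so `g(∂_{t*}, ∂_{t*}) = −1 + 2H ≤
−1/5`: `T` is uniformly timelike there; the ergoregion lies in `{r ≤ 2M}`, DRSR arXiv:1402.7034,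
§2.2.4). [cite: DafermosRodnianskiShlapentokhrothman2014, §2.2.4] -/
theorem surgeryProfile_le_of_farCutoff_ne_zero {M a : ℝ} (hMa : IsSubextremal M a) {x : E4}
    (hx : x ∈ (exterior M a : Set E4)) (hχ : radialTransition (11 * M / 4) (M / 4) (E4.spatial x) ≠ 0) :
    surgeryProfile M a (rPlus M a) x ≤ 4 / 5 := by
  have hM : 0 < M := hMa.pos
  have hr := (radius_gt_of_lt_spatialNorm hMa (lt_spatialNorm_of_farCutoff_ne_zero hM hχ)).1
  have hrp : rPlus M a ≤ radius a x := (lt_radius_of_mem_region hx).le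
  have hr0 : 0 < radius a x := lt_trans (by positivity) hr
  rw [surgeryProfile_eq_of_le hMa.rPlus_pos hrp]
  have hH := scalarH_le_div hM.le a hr0
  have : M / radius a x ≤ 2 / 5 := by
    rw [div_le_div_iff₀ hr0 (by norm_num : (0 : ℝ) < 5)]
    linarith
  linarith

/-! ### A derivative bound for the surgered background, uniform in `|a| < M` -/

/-- **The derivative bound `Kerr.surgeryDerivBound M a r₊ C_σ` is uniform on the sub-extremal
family**: `≤ (4640 + 80 C_σ)/M` for `|a| < M` (`M ≤ r₊ ≤ 2M`, `|a| ≤ M`; every term of the explicit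
bound is monotone in `|a|` and antitone in `r₀`). [folklore] -/
theorem surgeryDerivBound_rPlus_le {M a Cσ : ℝ} (hMa : IsSubextremal M a) (hC : 0 ≤ Cσ) :
    surgeryDerivBound M a (rPlus M a) Cσ ≤ (4640 + 80 * Cσ) / M := by
  have hM : 0 < M := hMa.pos
  have haM : |a| ≤ M := le_of_lt hMa
  have ha0 : 0 ≤ |a| := abs_nonneg a
  have hr1 : M ≤ rPlus M a := by
    unfold rPlus; linarith [Real.sqrt_nonneg (M ^ 2 - a ^ 2)]
  have hr2 : rPlus M a ≤ 2 * M := rPlus_le_two_mul hM.le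
  set r := rPlus M a with hr
  have hrpos : 0 < r := lt_of_lt_of_le hM hr1
  -- the ratio `|a|/(r/4) ≤ 4`, `M/r ≤ 1`, `1/r ≤ 1/M`
  have hq : |a| / (r / 4) ≤ 4 := by
    rw [div_le_iff₀ (by positivity)]; linarith
  have hq0 : 0 ≤ |a| / (r / 4) := by positivity
  have h4M : 4 * M / r ≤ 4 := by rw [div_le_iff₀ hrpos]; linarith
  have hir : 1 / (r / 4) ≤ 4 / M := by
    rw [div_le_div_iff₀ (by positivity) hM]; linarith
  have hir2 : 1 / (r / 4) ^ 2 ≤ 16 / M ^ 2 := by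
    rw [div_le_div_iff₀ (by positivity) (by positivity)]; nlinarith
  have habs : |2 / r| ≤ 2 / M := by
    rw [abs_of_pos (by positivity), div_le_div_iff₀ hrpos hM]; linarith
  unfold surgeryDerivBound
  -- term 1
  have t1 : 2 * (4 * M / r) * ((21 * (1 + |a| / (r / 4)) + 5) / (r / 4)) ≤ 3520 / M := by
    have hA : (21 * (1 + |a| / (r / 4)) + 5) ≤ 110 := by linarith
    have hB : (21 * (1 + |a| / (r / 4)) + 5) / (r / 4) ≤ 110 * (4 / M) := by
      rw [div_eq_mul_one_div]
      exact mul_le_mul hA hir (by positivity) (by norm_num)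
    have hB0 : 0 ≤ (21 * (1 + |a| / (r / 4)) + 5) / (r / 4) := by positivity
    have hprod : (4 * M / r) * ((21 * (1 + |a| / (r / 4)) + 5) / (r / 4)) ≤ 4 * (110 * (4 / M)) :=
      mul_le_mul h4M hB hB0 (by norm_num)
    calc _ = 2 * ((4 * M / r) * ((21 * (1 + |a| / (r / 4)) + 5) / (r / 4))) := by ring
      _ ≤ 2 * (4 * (110 * (4 / M))) := by linarith
      _ = 3520 / M := by ring
  -- term 2
  have t2 : 2 * (M * (5 * (1 + |a| / (r / 4)) + 2 + 2 * |a| / (r / 4)) / (r / 4) ^ 2) ≤ 1120 / M := by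
    have hA : 5 * (1 + |a| / (r / 4)) + 2 + 2 * |a| / (r / 4) ≤ 35 := by
      have : 2 * |a| / (r / 4) = 2 * (|a| / (r / 4)) := by ring
      rw [this]; linarith
    have hB : M * (5 * (1 + |a| / (r / 4)) + 2 + 2 * |a| / (r / 4)) / (r / 4) ^ 2 ≤
        M * 35 * (16 / M ^ 2) := by
      rw [div_eq_mul_one_div]
      exact mul_le_mul (mul_le_mul_of_nonneg_left hA hM.le) hir2 (by positivity) (by positivity)
    calc _ ≤ 2 * (M * 35 * (16 / M ^ 2)) := by linarith
      _ = 1120 / M := by field_simp; ring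
  -- term 3
  have t3 : 2 * (M / (r / 4)) * (Cσ * |2 / r| * (1 + |a| / (r / 4))) ≤ 80 * Cσ / M := by
    have hA : M / (r / 4) ≤ 4 := by rw [div_le_iff₀ (by positivity)]; linarith
    have hB : Cσ * |2 / r| * (1 + |a| / (r / 4)) ≤ Cσ * (2 / M) * 5 :=
      mul_le_mul (mul_le_mul_of_nonneg_left habs hC) (by linarith) (by positivity) (by positivity)
    have hB0 : 0 ≤ Cσ * |2 / r| * (1 + |a| / (r / 4)) := by positivity
    have hprod : (M / (r / 4)) * (Cσ * |2 / r| * (1 + |a| / (r / 4))) ≤ 4 * (Cσ * (2 / M) * 5) :=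
      mul_le_mul hA hB hB0 (by norm_num)
    calc _ = 2 * ((M / (r / 4)) * (Cσ * |2 / r| * (1 + |a| / (r / 4)))) := by ring
      _ ≤ 2 * (4 * (Cσ * (2 / M) * 5)) := by linarith
      _ = 80 * Cσ / M := by ring
  calc _ ≤ 3520 / M + (1120 / M + 80 * Cσ / M) := add_le_add t1 (add_le_add t2 t3)
    _ = (4640 + 80 * Cσ) / M := by ring

/-- **Uniform `C¹` bound for the surgered backgrounds of the sub-extremal family**: for `|a| < M`
and all `x`, `|∂_μ g^{αβ}(x)| ≤ (4640 + 80 C_σ)/M` for the inverse metric of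
`Kerr.surgeryBackground M a r₊` (`Kerr.exists_hasFDerivAt_surgery_leaf` with the explicit bound,
stationarity, and `surgeryDerivBound_rPlus_le`). [cite: KerrSchild1965, §2] -/
theorem abs_fderiv_surgeryBackground_rPlus_le {M a Cσ : ℝ} (hMa : IsSubextremal M a)
    (hCσ : ∀ s, |deriv Real.smoothTransition s| ≤ Cσ) (x : E4) (μ α β : Fin 4) :
    |fderiv ℝ (fun z ↦ (surgeryBackground M a (rPlus M a) hMa.pos.le hMa.rPlus_pos).inverseMetric z α β)
        x (E4.basisVector μ)| ≤ (4640 + 80 * Cσ) / M := by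
  have hC0 : 0 ≤ Cσ := (abs_nonneg _).trans (hCσ 0)
  have hM := hMa.pos
  have hr₀ := hMa.rPlus_pos
  refine le_trans ?_ (surgeryDerivBound_rPlus_le hMa hC0)
  set gL : E3 → ℝ := fun y ↦
    (surgeryBackground M a (rPlus M a) hM.le hr₀).inverseMetric (E4.ofTimeSpace 0 y) α β with hgL
  have hleaf : (fun z ↦ (surgeryBackground M a (rPlus M a) hM.le hr₀).inverseMetric z α β) =
      gL ∘ E4.spatial :=
    funext fun z ↦ surgeryBackground_inverseMetric_eq_leaf hM.le a hr₀ z α β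
  obtain ⟨L, hL, hLn⟩ := exists_hasFDerivAt_surgery_leaf hM.le a hr₀ hCσ α β (E4.spatial x)
  rw [hleaf, (hL.comp x E4.spatial.hasFDerivAt).fderiv, ContinuousLinearMap.comp_apply]
  have hsp : ‖E4.spatial (E4.basisVector μ)‖ ≤ 1 := by
    have hle : E4.spatialNorm (E4.basisVector μ) ^ 2 ≤ 1 := by
      rw [E4.spatialNorm_sq]
      fin_cases μ <;> simp [E4.basisVector]
    have h0 : 0 ≤ E4.spatialNorm (E4.basisVector μ) := E4.spatialNorm_nonneg _
    show E4.spatialNorm (E4.basisVector μ) ≤ 1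
    nlinarith
  have hD0 := surgeryDerivBound_nonneg hM.le a hr₀ hC0
  calc |L (E4.spatial (E4.basisVector μ))| = ‖L (E4.spatial (E4.basisVector μ))‖ :=
        (Real.norm_eq_abs _).symm
    _ ≤ ‖L‖ * ‖E4.spatial (E4.basisVector μ)‖ := L.le_opNorm _
    _ ≤ surgeryDerivBound M a (rPlus M a) Cσ * 1 := mul_le_mul hLn hsp (norm_nonneg _) hD0
    _ = surgeryDerivBound M a (rPlus M a) Cσ := mul_one _

/-- **Stationarity of the surgered background in derivative form**: `∂_0 g^{αβ} = 0` everywhere.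
[cite: KerrSchild1965, §2] -/
theorem fderiv_surgeryBackground_basisVector_zero {M : ℝ} (hM : 0 ≤ M) (a : ℝ) {r₀ : ℝ}
    (hr₀ : 0 < r₀) (x : E4) (α β : Fin 4) :
    fderiv ℝ (fun y ↦ (surgeryBackground M a r₀ hM hr₀).inverseMetric y α β) x
      (E4.basisVector 0) = 0 := by
  set g : E4 → ℝ := fun y ↦ (surgeryBackground M a r₀ hM hr₀).inverseMetric y α β with hg
  have hgd : DifferentiableAt ℝ g x :=
    (((surgeryBackground M a r₀ hM hr₀).contDiff_inverseMetric α β).differentiable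
      (by simp)).differentiableAt
  have h1 : HasDerivAt (fun t : ℝ ↦ g (x + t • E4.basisVector 0))
      (fderiv ℝ g x (E4.basisVector 0)) 0 :=
    hgd.hasFDerivAt.hasLineDerivAt (E4.basisVector 0)
  have hconst : (fun t : ℝ ↦ g (x + t • E4.basisVector 0)) = fun _ ↦ g x :=
    funext fun t ↦ surgeryBackground_inverseMetric_add_smul_basisVector_zero hM a hr₀ x t α β
  rw [hconst] at h1
  exact h1.unique (hasDerivAt_const 0 (g x))

/-! ### The receding horizon weight `W_ε = σ(u₂/ε − 1)` -/

/-- The horizon function `u₂ = (r − r₊) e^{−t*/(2M)}` is continuous on `ℝ⁴`. [folklore] -/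
theorem continuous_horizonFn (M a : ℝ) : Continuous (horizonFn M a) := by
  show Continuous fun x : E4 ↦ (radius a x - rPlus M a) * Real.exp (-((2 * M)⁻¹ * x 0))
  exact ((continuous_radius a).sub continuous_const).mul
    (Real.continuous_exp.comp (continuous_const.mul (contDiff_apply_zero (n := 0)).continuous).neg)

/-- A point where the horizon function is positive lies in the exterior chart `{r > r₊}` (for
`r₊ > 0`). [folklore] -/
theorem mem_exterior_of_horizonFn_pos {M a : ℝ} (hrp : 0 < rPlus M a) {x : E4}
    (h : 0 < horizonFn M a x) : x ∈ (exterior M a : Set E4) := by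
  have hexp : 0 < Real.exp (-((2 * M)⁻¹ * x 0)) := Real.exp_pos _
  have : 0 < radius a x - rPlus M a := by
    by_contra hle
    exact absurd h (not_lt.mpr (mul_nonpos_of_nonpos_of_nonneg (not_lt.mp hle) hexp.le))
  rw [SetLike.mem_coe, mem_exterior, max_eq_left hrp.le]
  linarith

/-- Where the receding weight `σ(u₂/ε − 1)` is nonzero, `u₂ > ε`. [folklore] -/
theorem lt_horizonFn_of_weight_ne_zero {M a ε : ℝ} (hε : 0 < ε) {x : E4}
    (hx : Real.smoothTransition (horizonFn M a x / ε - 1) ≠ 0) : ε < horizonFn M a x := by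
  have hh : 0 < horizonFn M a x / ε - 1 := by
    by_contra h
    exact hx (Real.smoothTransition.zero_of_nonpos (not_lt.mp h))
  have : 1 < horizonFn M a x / ε := by linarith
  rwa [lt_div_iff₀ hε, one_mul] at this

/-- The receding weight is saturated, `σ(u₂/ε − 1) = 1`, where `u₂ ≥ 2ε`. [folklore] -/
theorem weight_eq_one_of_le_horizonFn {M a ε : ℝ} (hε : 0 < ε) {x : E4}
    (hx : 2 * ε ≤ horizonFn M a x) : Real.smoothTransition (horizonFn M a x / ε - 1) = 1 := by
  refine Real.smoothTransition.one_of_one_le ?_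
  have : 2 ≤ horizonFn M a x / ε := by rw [le_div_iff₀ hε]; linarith
  linarith

/-- **The receding layer stays near the horizon on a finite slab**: for `ε ≤ (M/4) e^{−τ/(2M)}`, at a
point with `x⁰ ≤ τ` and `r > r₊ + M/2` the weight `σ(u₂/ε − 1)` is identically `1` nearby, so its
derivative vanishes there. [folklore] -/
theorem fderiv_weight_eq_zero_of_lt_radius {M a ε τ : ℝ} (hM : 0 < M) (hε : 0 < ε)
    (hεsmall : ε ≤ M / 4 * Real.exp (-((2 * M)⁻¹ * τ))) {x : E4} (hxτ : x 0 ≤ τ)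
    (hr : rPlus M a + M / 2 < radius a x) :
    fderiv ℝ (fun y ↦ Real.smoothTransition (horizonFn M a y / ε - 1)) x = 0 := by
  have hexp : Real.exp (-((2 * M)⁻¹ * τ)) ≤ Real.exp (-((2 * M)⁻¹ * x 0)) := by
    rw [Real.exp_le_exp]
    have : 0 < (2 * M)⁻¹ := by positivity
    nlinarith
  have hexp0 : 0 < Real.exp (-((2 * M)⁻¹ * τ)) := Real.exp_pos _
  have hlt : 2 * ε < horizonFn M a x := by
    show 2 * ε < (radius a x - rPlus M a) * Real.exp (-((2 * M)⁻¹ * x 0))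
    calc 2 * ε ≤ M / 2 * Real.exp (-((2 * M)⁻¹ * τ)) := by linarith
      _ < (radius a x - rPlus M a) * Real.exp (-((2 * M)⁻¹ * τ)) :=
          mul_lt_mul_of_pos_right (by linarith) hexp0
      _ ≤ (radius a x - rPlus M a) * Real.exp (-((2 * M)⁻¹ * x 0)) :=
          mul_le_mul_of_nonneg_left hexp (by linarith)
  have hO : IsOpen {y : E4 | 2 * ε < horizonFn M a y} :=
    isOpen_lt continuous_const (continuous_horizonFn M a)
  have hev : (fun y ↦ Real.smoothTransition (horizonFn M a y / ε - 1)) =ᶠ[𝓝 x]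
      fun _ ↦ (1 : ℝ) := by
    filter_upwards [hO.mem_nhds hlt] with y hy
    exact weight_eq_one_of_le_horizonFn hε hy.le
  rw [hev.fderiv_eq, fderiv_const_apply]

/-! ### The weighted slab identity for a current which is the `dt`-current near the horizon -/

/-- **The weighted energy inequality on a slab, up to the horizon.** Let `(M, a)` be sub-extremal,
`Cur = (Cur^μ)` a current on `ℝ⁴` which is `C¹` at the exterior points with divergence `bulk` there
(`bulk` continuous at the exterior points), which coincides with the `dt`-current `P[Φ]` of the
surgered background at the exterior points with `r ≤ r₊ + M/2`, and which vanishes at the exterior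
points of the slab `{0 ≤ t ≤ τ}` beyond `‖x⃗‖ = ρ₀`. Then for the receding weight
`W = σ(u₂/ε − 1)` with `0 < ε ≤ (M/4) e^{−τ/(2M)}` and every ball radius `ρ ≥ ρ₀`,
`∫_{B_ρ} W Cur⁰(τ, y) dy ≤ ∫_{B_ρ} W Cur⁰(0, y) dy + ∫_{(0,τ]} ∫_{B_ρ} W |bulk| (t, y) dy dt`:
the divergence identity for `W Cur` (`E4.ballIntegral_sub_eq_integral_divergence`) with
`∑ ∂_μ(W Cur^μ) = ∑ (∂_μ W) Cur^μ + W · bulk` and the sign `∑ (∂_μ W) P^μ ≤ 0` of the flux through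
the receding layer (`Kerr.horizonFactor_flux`, dominant energy condition; the layer lies in
`{r ≤ r₊ + M/2}`). Hawking–Ellis 1973, §4.3, Lemma 4.3.1, in the weighted form of
`KerrSchild.Background.weightedEnergy_sub_eq`. [cite: HawkingEllis1973CUP, §4.3 Lemma 4.3.1] -/
theorem weightedSlab_le {M a : ℝ} (hMa : IsSubextremal M a) {Φ : E4 → ℝ}
    {Cur : Fin 4 → E4 → ℝ} {bulk : E4 → ℝ} {ρ₀ ρ τ ε : ℝ}
    (hCur1 : ∀ μ, ∀ x ∈ (exterior M a : Set E4), ContDiffAt ℝ 1 (Cur μ) x)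
    (hdiv : ∀ x ∈ (exterior M a : Set E4), ∑ μ, fderiv ℝ (Cur μ) x (E4.basisVector μ) = bulk x)
    (hbulkc : ∀ x ∈ (exterior M a : Set E4), ContinuousAt bulk x)
    (hnear : ∀ x ∈ (exterior M a : Set E4), radius a x ≤ rPlus M a + M / 2 → ∀ μ,
      Cur μ x = KerrSchild.normalCurrent
        (surgeryBackground M a (rPlus M a) hMa.pos.le hMa.rPlus_pos).inverseMetric Φ x μ)
    (hCurfar : ∀ x ∈ (exterior M a : Set E4), 0 ≤ x 0 → x 0 ≤ τ → ρ₀ < E4.spatialNorm x →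
      ∀ μ, Cur μ x = 0)
    (hτ : 0 ≤ τ) (hρ : ρ₀ ≤ ρ) (hε : 0 < ε) (hεsmall : ε ≤ M / 4 * Real.exp (-((2 * M)⁻¹ * τ))) :
    (∫ y in closedBall (0 : E3) ρ, Real.smoothTransition (horizonFn M a (E4.ofTimeSpace τ y) / ε - 1) *
        Cur 0 (E4.ofTimeSpace τ y)) ≤
      (∫ y in closedBall (0 : E3) ρ, Real.smoothTransition (horizonFn M a (E4.ofTimeSpace 0 y) / ε - 1) *
        Cur 0 (E4.ofTimeSpace 0 y)) +
      ∫ t in Ioc (0 : ℝ) τ, ∫ y in closedBall (0 : E3) ρ,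
        Real.smoothTransition (horizonFn M a (E4.ofTimeSpace t y) / ε - 1) *
          |bulk (E4.ofTimeSpace t y)| := by
  have hM : 0 < M := hMa.pos
  have hrp : 0 < rPlus M a := hMa.rPlus_pos
  -- the weight and its support
  set W : E4 → ℝ := fun x ↦ Real.smoothTransition (horizonFn M a x / ε - 1) with hW
  set K : Set E4 := {x | ε ≤ horizonFn M a x} with hK
  have hKc : IsClosed K := isClosed_le continuous_const (continuous_horizonFn M a)
  have hKU : K ⊆ (exterior M a : Set E4) := fun x hx ↦
    mem_exterior_of_horizonFn_pos hrp (lt_of_lt_of_le hε hx)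
  have hWK : ∀ x, W x ≠ 0 → x ∈ K := fun x hx ↦ (lt_horizonFn_of_weight_ne_zero hε hx).le
  have hW1 : ContDiff ℝ 1 W := contDiff_horizonFactor hrp hε
  have hW0 : ∀ x, 0 ≤ W x := fun x ↦ Real.smoothTransition.nonneg _
  have hWz : ∀ x, x ∉ K → W x = 0 := fun x hx ↦ by
    by_contra h; exact hx (hWK x h)
  -- the flux through the receding layer has a sign
  have hflux : ∀ x ∈ K, x 0 ≤ τ → ∑ μ, fderiv ℝ W x (E4.basisVector μ) * Cur μ x ≤ 0 := by
    intro x hxK hxτ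
    have hx := hKU hxK
    rcases le_or_gt (radius a x) (rPlus M a + M / 2) with hr | hr
    · have h := horizonFactor_flux hMa Φ hε (lt_radius_of_mem_region hx)
      simpa only [← hnear x hx hr] using h
    · rw [show fderiv ℝ W x = 0 from fderiv_weight_eq_zero_of_lt_radius hM hε hεsmall hxτ hr]
      simp
  -- the weighted current
  set J : Fin 4 → E4 → ℝ := fun μ x ↦ W x * Cur μ x with hJ
  have hJ1 : ∀ μ, ContDiff ℝ 1 (J μ) := fun μ ↦
    contDiff_iff_contDiffAt.mpr fun x ↦ contDiffAt_weight_mul hKc hKU hW1 hWK (hCur1 μ) x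
  have hJfar : ∀ μ, ∀ t ∈ Icc (0 : ℝ) τ, ∀ y : E3, ρ < ‖y‖ → J μ (E4.ofTimeSpace t y) = 0 := by
    intro μ t ht y hy
    by_cases hWx : W (E4.ofTimeSpace t y) = 0
    · simp only [hJ, hWx, zero_mul]
    · have hx : E4.ofTimeSpace t y ∈ (exterior M a : Set E4) := hKU (hWK _ hWx)
      have h0 : Cur μ (E4.ofTimeSpace t y) = 0 :=
        hCurfar _ hx (by simpa using ht.1) (by simpa using ht.2)
          (by rw [E4.spatialNorm_ofTimeSpace]; linarith) μ
      simp only [hJ, h0, mul_zero]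
  -- the divergence identity on the slab
  have hid := E4.ballIntegral_sub_eq_integral_divergence hJ1 hτ (ρ := ρ)
    fun i t ht y hy ↦ hJfar i.succ t ht y hy
  -- the divergence and its continuous majorant `G = W |bulk|`
  set divJ : E4 → ℝ := fun x ↦ ∑ μ, fderiv ℝ (J μ) x (E4.basisVector μ) with hdivJ
  set G : E4 → ℝ := fun x ↦ W x * |bulk x| with hG
  have hdivJc : Continuous divJ := continuous_finsetSum _ fun μ _ ↦
    ((hJ1 μ).continuous_fderiv one_ne_zero).clm_apply continuous_const
  have hGc : Continuous G := continuous_iff_continuousAt.mpr fun x ↦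
    continuousAt_weight_mul hKc hKU hW1.continuous hWz (fun y hy ↦ (hbulkc y hy).abs) x
  -- pointwise: `div J ≤ G` on `{t ≤ τ}`
  have hpt : ∀ x : E4, x 0 ≤ τ → divJ x ≤ G x := by
    intro x hxτ
    by_cases hxK : x ∈ K
    · have hx := hKU hxK
      have hWd : DifferentiableAt ℝ W x := (hW1.differentiable one_ne_zero) x
      have hCd : ∀ μ, DifferentiableAt ℝ (Cur μ) x := fun μ ↦
        (hCur1 μ x hx).differentiableAt one_ne_zero
      have hprod : ∀ μ, fderiv ℝ (J μ) x (E4.basisVector μ) =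
          fderiv ℝ W x (E4.basisVector μ) * Cur μ x +
            W x * fderiv ℝ (Cur μ) x (E4.basisVector μ) := by
        intro μ
        have : J μ = fun y ↦ W y * Cur μ y := rfl
        rw [this, fderiv_fun_mul hWd (hCd μ)]
        simp only [add_apply, FunLike.coe_smul, Pi.smul_apply, smul_eq_mul]
        ring
      have hsum : divJ x = (∑ μ, fderiv ℝ W x (E4.basisVector μ) * Cur μ x) + W x * bulk x := by
        simp only [hdivJ, hprod, Finset.sum_add_distrib, ← Finset.mul_sum, hdiv x hx]
      rw [hsum]
      calc _ ≤ 0 + W x * |bulk x| :=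
            add_le_add (hflux x hxK hxτ) (mul_le_mul_of_nonneg_left (le_abs_self _) (hW0 x))
        _ = G x := by rw [zero_add]
    · have hJ0 : ∀ μ, fderiv ℝ (J μ) x = 0 := fun μ ↦
        fderiv_eq_zero_of_forall_mem_eq_zero hKc.isOpen_compl
          (fun y hy ↦ by simp only [hJ, hWz y hy, zero_mul]) hxK
      have h0 : divJ x = 0 := by
        simp only [hdivJ, hJ0, zero_apply, Finset.sum_const_zero]
      rw [h0]
      exact mul_nonneg (hW0 x) (abs_nonneg _)
  -- integrate
  have hmono : ∫ t in Ioc (0 : ℝ) τ, ∫ y in closedBall (0 : E3) ρ, divJ (E4.ofTimeSpace t y) ≤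
      ∫ t in Ioc (0 : ℝ) τ, ∫ y in closedBall (0 : E3) ρ, G (E4.ofTimeSpace t y) := by
    have hc1 : Continuous fun t ↦ ∫ y in closedBall (0 : E3) ρ, divJ (E4.ofTimeSpace t y) :=
      KerrSchild.Background.continuous_ballIntegral hdivJc ρ
    have hc2 : Continuous fun t ↦ ∫ y in closedBall (0 : E3) ρ, G (E4.ofTimeSpace t y) :=
      KerrSchild.Background.continuous_ballIntegral hGc ρ
    refine setIntegral_mono_on (hc1.integrableOn_Icc.mono_set Ioc_subset_Icc_self)
      (hc2.integrableOn_Icc.mono_set Ioc_subset_Icc_self) measurableSet_Ioc fun t ht ↦ ?_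
    have hi1 : IntegrableOn (fun y : E3 ↦ divJ (E4.ofTimeSpace t y)) (closedBall (0 : E3) ρ) :=
      (hdivJc.comp (E4.continuous_ofTimeSpace t)).continuousOn.integrableOn_compact
        (isCompact_closedBall _ _)
    have hi2 : IntegrableOn (fun y : E3 ↦ G (E4.ofTimeSpace t y)) (closedBall (0 : E3) ρ) :=
      (hGc.comp (E4.continuous_ofTimeSpace t)).continuousOn.integrableOn_compact
        (isCompact_closedBall _ _)
    exact setIntegral_mono_on hi1 hi2 measurableSet_closedBall fun y _ ↦
      hpt _ (by simpa using ht.2)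
  have h1 : (∫ y in closedBall (0 : E3) ρ, J 0 (E4.ofTimeSpace τ y)) -
      (∫ y in closedBall (0 : E3) ρ, J 0 (E4.ofTimeSpace 0 y)) =
      ∫ t in Ioc (0 : ℝ) τ, ∫ y in closedBall (0 : E3) ρ, divJ (E4.ofTimeSpace t y) := hid
  show (∫ y in closedBall (0 : E3) ρ, J 0 (E4.ofTimeSpace τ y)) ≤
    (∫ y in closedBall (0 : E3) ρ, J 0 (E4.ofTimeSpace 0 y)) +
      ∫ t in Ioc (0 : ℝ) τ, ∫ y in closedBall (0 : E3) ρ, G (E4.ofTimeSpace t y)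
  linarith

set_option maxHeartbeats 400000 in
/-- **The estimate on the saturated set of the weight, in `[0, ∞]`.** Under the hypotheses of
`weightedSlab_le`, if moreover `|bulk| ≤ C_K ∑_μ (∂_μΦ)²` everywhere with `bulk = 0` beyond
`‖x⃗‖ = 3M`, `Cur⁰ ≤ 75 ∑ (∂Φ)²` and `∑ (∂Φ)² ≤ 10 Cur⁰` at the exterior points, then for every
`R`:
`∫_{{‖y‖ ≤ R} ∩ {u₂(τ, y) ≥ 2ε}} ∑ (∂Φ)²(τ, y) dy ≤ 750 E(0) + 10 C_K ∫_{(0,τ]} E_loc(t, 3M) dt`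
(on the saturated set `W = 1`; the weighted energy at time `0` is at most `75 E(0)`; the weighted bulk
integral is at most `C_K` times the local energy integral). Dafermos–Rodnianski arXiv:0811.0354,
§4.1: `E^N(τ) ≤ E^N(0) + B ∫∫_{r ≤ R} |∂ψ|²`. [cite: DafermosRodnianski2008, §4.1] -/
theorem saturated_lintegral_le {M a : ℝ} (hMa : IsSubextremal M a) {Φ : E4 → ℝ}
    {Cur : Fin 4 → E4 → ℝ} {bulk : E4 → ℝ} {ρ₀ τ ε R CK : ℝ}
    (hCur1 : ∀ μ, ∀ x ∈ (exterior M a : Set E4), ContDiffAt ℝ 1 (Cur μ) x)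
    (hdiv : ∀ x ∈ (exterior M a : Set E4), ∑ μ, fderiv ℝ (Cur μ) x (E4.basisVector μ) = bulk x)
    (hbulkc : ∀ x ∈ (exterior M a : Set E4), ContinuousAt bulk x)
    (hnear : ∀ x ∈ (exterior M a : Set E4), radius a x ≤ rPlus M a + M / 2 → ∀ μ,
      Cur μ x = KerrSchild.normalCurrent
        (surgeryBackground M a (rPlus M a) hMa.pos.le hMa.rPlus_pos).inverseMetric Φ x μ)
    (hCurfar : ∀ x ∈ (exterior M a : Set E4), 0 ≤ x 0 → x 0 ≤ τ → ρ₀ < E4.spatialNorm x →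
      ∀ μ, Cur μ x = 0)
    (hCK0 : 0 ≤ CK)
    (hbulk : ∀ x ∈ (exterior M a : Set E4), |bulk x| ≤ CK * ∑ μ, fderiv ℝ Φ x (E4.basisVector μ) ^ 2)
    (hbulk0 : ∀ x, 3 * M < E4.spatialNorm x → bulk x = 0)
    (hup : ∀ x ∈ (exterior M a : Set E4), Cur 0 x ≤ 75 * ∑ μ, fderiv ℝ Φ x (E4.basisVector μ) ^ 2)
    (hlow : ∀ x ∈ (exterior M a : Set E4), ∑ μ, fderiv ℝ Φ x (E4.basisVector μ) ^ 2 ≤ 10 * Cur 0 x)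
    (hτ : 0 ≤ τ) (hε : 0 < ε) (hεsmall : ε ≤ M / 4 * Real.exp (-((2 * M)⁻¹ * τ))) :
    ∫⁻ y in {y : E3 | ‖y‖ ≤ R ∧ 2 * ε ≤ horizonFn M a (E4.ofTimeSpace τ y)},
        ENNReal.ofReal (∑ μ, fderiv ℝ Φ (E4.ofTimeSpace τ y) (E4.basisVector μ) ^ 2) ≤
      ENNReal.ofReal 750 *
          (∫⁻ y, {y : E3 | E4.ofTimeSpace 0 y ∈ exterior M a}.indicator
            (fun y ↦ ENNReal.ofReal (∑ μ, fderiv ℝ Φ (E4.ofTimeSpace 0 y) (E4.basisVector μ) ^ 2)) y) +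
        ENNReal.ofReal (10 * CK) *
          ∫⁻ t in Ioc (0 : ℝ) τ, ∫⁻ y in closedBall (0 : E3) (3 * M),
            {y : E3 | E4.ofTimeSpace t y ∈ exterior M a}.indicator
              (fun y ↦ ENNReal.ofReal (∑ μ, fderiv ℝ Φ (E4.ofTimeSpace t y) (E4.basisVector μ) ^ 2)) y := by
  have hM : 0 < M := hMa.pos
  have hrp : 0 < rPlus M a := hMa.rPlus_pos
  set ρ : ℝ := max ρ₀ R with hρdef
  have hineq := weightedSlab_le hMa hCur1 hdiv hbulkc hnear hCurfar hτ (le_max_left ρ₀ R) hε hεsmall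
  -- notation
  set W : E4 → ℝ := fun x ↦ Real.smoothTransition (horizonFn M a x / ε - 1) with hW
  set S : E4 → ℝ := fun x ↦ ∑ μ, fderiv ℝ Φ x (E4.basisVector μ) ^ 2 with hS
  set f : ℝ → E3 → ℝ≥0∞ := fun t y ↦ ENNReal.ofReal (S (E4.ofTimeSpace t y)) with hf
  have hS0 : ∀ x, 0 ≤ S x := fun x ↦ Finset.sum_nonneg fun _ _ ↦ sq_nonneg _
  have hWne : ∀ x, W x ≠ 0 → x ∈ (exterior M a : Set E4) := fun x hx ↦
    mem_exterior_of_horizonFn_pos hrp (hε.trans (lt_horizonFn_of_weight_ne_zero hε hx))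
  have hW0 : ∀ x, 0 ≤ W x := fun x ↦ Real.smoothTransition.nonneg _
  have hWle : ∀ x, W x ≤ 1 := fun x ↦ Real.smoothTransition.le_one _
  have hW1 : ContDiff ℝ 1 W := contDiff_horizonFactor hrp hε
  set K : Set E4 := {x | ε ≤ horizonFn M a x} with hK
  have hKc : IsClosed K := isClosed_le continuous_const (continuous_horizonFn M a)
  have hKU : K ⊆ (exterior M a : Set E4) := fun x hx ↦
    mem_exterior_of_horizonFn_pos hrp (lt_of_lt_of_le hε hx)
  have hWK : ∀ x, W x ≠ 0 → x ∈ K := fun x hx ↦ (lt_horizonFn_of_weight_ne_zero hε hx).le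
  have hWz : ∀ x, x ∉ K → W x = 0 := fun x hx ↦ by
    by_contra h; exact hx (hWK x h)
  -- the three real integrands and their regularity
  set J0 : E4 → ℝ := fun x ↦ W x * Cur 0 x with hJ0
  set G : E4 → ℝ := fun x ↦ W x * |bulk x| with hG
  have hJ0c : Continuous J0 := (contDiff_iff_contDiffAt.mpr fun x ↦
    contDiffAt_weight_mul hKc hKU hW1 hWK (hCur1 0) x).continuous
  have hGc : Continuous G := continuous_iff_continuousAt.mpr fun x ↦
    continuousAt_weight_mul hKc hKU hW1.continuous hWz (fun y hy ↦ (hbulkc y hy).abs) x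
  have hJ0nn : ∀ x, 0 ≤ J0 x := by
    intro x
    by_cases hWx : W x = 0
    · simp only [hJ0, hWx, zero_mul]; exact le_rfl
    · have := hlow x (hWne x hWx)
      exact mul_nonneg (hW0 x) (by linarith [hS0 x])
  have hG0 : ∀ x, 0 ≤ G x := fun x ↦ mul_nonneg (hW0 x) (abs_nonneg _)
  set F : ℝ → ℝ := fun t ↦ ∫ y in closedBall (0 : E3) ρ, J0 (E4.ofTimeSpace t y) with hF
  set Ig : ℝ := ∫ t in Ioc (0 : ℝ) τ, ∫ y in closedBall (0 : E3) ρ, G (E4.ofTimeSpace t y) with hIg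
  have hF0 : 0 ≤ F 0 := setIntegral_nonneg measurableSet_closedBall fun y _ ↦ hJ0nn _
  have hIg0 : 0 ≤ Ig := setIntegral_nonneg measurableSet_Ioc fun t _ ↦
    setIntegral_nonneg measurableSet_closedBall fun y _ ↦ hG0 _
  have hFτ : F τ ≤ F 0 + Ig := hineq
  set E0 : ℝ≥0∞ := ∫⁻ y, {y : E3 | E4.ofTimeSpace 0 y ∈ exterior M a}.indicator (f 0) y with hE0
  set IL : ℝ≥0∞ := ∫⁻ t in Ioc (0 : ℝ) τ, ∫⁻ y in closedBall (0 : E3) (3 * M),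
    {y : E3 | E4.ofTimeSpace t y ∈ exterior M a}.indicator (f t) y with hIL
  -- (a) `∫∫ G ≤ C_K · IL`
  have hGle : ∀ t (y : E3), ENNReal.ofReal (G (E4.ofTimeSpace t y)) ≤
      (closedBall (0 : E3) (3 * M)).indicator (fun y ↦ ENNReal.ofReal CK *
        {y : E3 | E4.ofTimeSpace t y ∈ exterior M a}.indicator (f t) y) y := by
    intro t y
    by_cases hWx : W (E4.ofTimeSpace t y) = 0
    · simp only [hG, hWx, zero_mul, ENNReal.ofReal_zero]; exact zero_le
    · have hx : E4.ofTimeSpace t y ∈ (exterior M a : Set E4) := hWne _ hWx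
      by_cases hy : 3 * M < ‖y‖
      · have : bulk (E4.ofTimeSpace t y) = 0 :=
          hbulk0 _ (by rw [E4.spatialNorm_ofTimeSpace]; exact hy)
        simp only [hG, this, abs_zero, mul_zero, ENNReal.ofReal_zero]; exact zero_le
      · have hyB : y ∈ closedBall (0 : E3) (3 * M) := by
          rw [mem_closedBall, dist_zero_right]; exact not_lt.mp hy
        rw [indicator_of_mem hyB, indicator_of_mem (show y ∈ {y : E3 |
          E4.ofTimeSpace t y ∈ exterior M a} from hx), hf, ← ENNReal.ofReal_mul hCK0]
        refine ENNReal.ofReal_le_ofReal ?_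
        calc G (E4.ofTimeSpace t y) ≤ 1 * |bulk (E4.ofTimeSpace t y)| :=
              mul_le_mul_of_nonneg_right (hWle _) (abs_nonneg _)
          _ ≤ CK * S (E4.ofTimeSpace t y) := by rw [one_mul]; exact hbulk _ hx
  have hIgle : ENNReal.ofReal Ig ≤ ENNReal.ofReal CK * IL := by
    have hc2 : Continuous fun t ↦ ∫ y in closedBall (0 : E3) ρ, G (E4.ofTimeSpace t y) :=
      KerrSchild.Background.continuous_ballIntegral hGc ρ
    have hinn : ∀ t, 0 ≤ ∫ y in closedBall (0 : E3) ρ, G (E4.ofTimeSpace t y) := fun t ↦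
      setIntegral_nonneg measurableSet_closedBall fun y _ ↦ hG0 _
    rw [hIg, ofReal_integral_eq_lintegral_ofReal
      (hc2.integrableOn_Icc.mono_set Ioc_subset_Icc_self) (ae_of_all _ hinn)]
    calc ∫⁻ t in Ioc (0 : ℝ) τ, ENNReal.ofReal (∫ y in closedBall (0 : E3) ρ, G (E4.ofTimeSpace t y))
        ≤ ∫⁻ t in Ioc (0 : ℝ) τ, ENNReal.ofReal CK * ∫⁻ y in closedBall (0 : E3) (3 * M),
            {y : E3 | E4.ofTimeSpace t y ∈ exterior M a}.indicator (f t) y := by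
          refine lintegral_mono fun t ↦ ?_
          have hi2 : IntegrableOn (fun y : E3 ↦ G (E4.ofTimeSpace t y)) (closedBall (0 : E3) ρ) :=
            (hGc.comp (E4.continuous_ofTimeSpace t)).continuousOn.integrableOn_compact
              (isCompact_closedBall _ _)
          rw [ofReal_integral_eq_lintegral_ofReal hi2 (ae_of_all _ fun y ↦ hG0 _)]
          calc ∫⁻ y in closedBall (0 : E3) ρ, ENNReal.ofReal (G (E4.ofTimeSpace t y))
              ≤ ∫⁻ y, ENNReal.ofReal (G (E4.ofTimeSpace t y)) := setLIntegral_le_lintegral _ _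
            _ ≤ ∫⁻ y, (closedBall (0 : E3) (3 * M)).indicator (fun y ↦ ENNReal.ofReal CK *
                  {y : E3 | E4.ofTimeSpace t y ∈ exterior M a}.indicator (f t) y) y :=
                lintegral_mono fun y ↦ hGle t y
            _ = ∫⁻ y in closedBall (0 : E3) (3 * M), ENNReal.ofReal CK *
                  {y : E3 | E4.ofTimeSpace t y ∈ exterior M a}.indicator (f t) y :=
                lintegral_indicator measurableSet_closedBall _
            _ = ENNReal.ofReal CK * ∫⁻ y in closedBall (0 : E3) (3 * M),
                  {y : E3 | E4.ofTimeSpace t y ∈ exterior M a}.indicator (f t) y :=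
                lintegral_const_mul' _ _ ENNReal.ofReal_ne_top
      _ = ENNReal.ofReal CK * IL := by
          rw [hIL, lintegral_const_mul' _ _ ENNReal.ofReal_ne_top]
  -- (b) the initial weighted energy is at most `75 E(0)`
  have hF0le : ENNReal.ofReal (F 0) ≤ ENNReal.ofReal 75 * E0 := by
    have hJi : IntegrableOn (fun y : E3 ↦ J0 (E4.ofTimeSpace 0 y)) (closedBall (0 : E3) ρ) :=
      (hJ0c.comp (E4.continuous_ofTimeSpace 0)).continuousOn.integrableOn_compact
        (isCompact_closedBall _ _)
    rw [hF, ofReal_integral_eq_lintegral_ofReal hJi (ae_of_all _ fun y ↦ hJ0nn _)]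
    calc ∫⁻ y in closedBall (0 : E3) ρ, ENNReal.ofReal (J0 (E4.ofTimeSpace 0 y))
        ≤ ∫⁻ y in closedBall (0 : E3) ρ, {y : E3 | E4.ofTimeSpace 0 y ∈ exterior M a}.indicator
            (fun y ↦ ENNReal.ofReal 75 * f 0 y) y := by
          refine lintegral_mono fun y ↦ ?_
          by_cases hWy : W (E4.ofTimeSpace 0 y) = 0
          · simp only [hJ0, hWy, zero_mul, ENNReal.ofReal_zero]; exact zero_le
          · have hmem : E4.ofTimeSpace 0 y ∈ (exterior M a : Set E4) := hWne _ hWy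
            rw [indicator_of_mem (show y ∈ {y : E3 | E4.ofTimeSpace 0 y ∈ exterior M a} from
              hmem), hf, ← ENNReal.ofReal_mul (by norm_num)]
            refine ENNReal.ofReal_le_ofReal ?_
            have h75 := hup _ hmem
            have hl := hlow _ hmem
            have hC0 : 0 ≤ Cur 0 (E4.ofTimeSpace 0 y) := by linarith [hS0 (E4.ofTimeSpace 0 y)]
            calc J0 (E4.ofTimeSpace 0 y) ≤ 1 * Cur 0 (E4.ofTimeSpace 0 y) :=
                  mul_le_mul_of_nonneg_right (hWle _) hC0
              _ ≤ 75 * S (E4.ofTimeSpace 0 y) := by rw [one_mul]; exact h75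
      _ ≤ ∫⁻ y, {y : E3 | E4.ofTimeSpace 0 y ∈ exterior M a}.indicator
            (fun y ↦ ENNReal.ofReal 75 * f 0 y) y := setLIntegral_le_lintegral _ _
      _ = ENNReal.ofReal 75 * E0 := by
          rw [hE0, ← lintegral_const_mul' _ _ ENNReal.ofReal_ne_top]
          refine lintegral_congr fun y ↦ ?_
          by_cases hy : y ∈ {y : E3 | E4.ofTimeSpace 0 y ∈ exterior M a}
          · simp only [indicator_of_mem hy]
          · simp only [indicator_of_notMem hy, mul_zero]
  -- (c) on the saturated set the weighted energy at time `τ` dominates the energy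
  set Sset : Set E3 := {y : E3 | ‖y‖ ≤ R ∧ 2 * ε ≤ horizonFn M a (E4.ofTimeSpace τ y)} with hSset
  have hSm : MeasurableSet Sset :=
    ((isClosed_le continuous_norm continuous_const).inter (isClosed_le continuous_const
      ((continuous_horizonFn M a).comp (E4.continuous_ofTimeSpace τ)))).measurableSet
  have hSsub : Sset ⊆ closedBall (0 : E3) ρ := by
    intro y hy
    rw [mem_closedBall, dist_zero_right]
    exact hy.1.trans (le_max_right _ _)
  have hlowτ : ∫⁻ y in Sset, f τ y ≤ ENNReal.ofReal (10 * F τ) := by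
    have hJi : IntegrableOn (fun y : E3 ↦ J0 (E4.ofTimeSpace τ y)) (closedBall (0 : E3) ρ) :=
      (hJ0c.comp (E4.continuous_ofTimeSpace τ)).continuousOn.integrableOn_compact
        (isCompact_closedBall _ _)
    calc ∫⁻ y in Sset, f τ y ≤ ∫⁻ y in Sset, ENNReal.ofReal (10 * J0 (E4.ofTimeSpace τ y)) := by
          refine setLIntegral_mono' hSm fun y hy ↦ ENNReal.ofReal_le_ofReal ?_
          have hWy : W (E4.ofTimeSpace τ y) = 1 := weight_eq_one_of_le_horizonFn hε hy.2
          have hmem : E4.ofTimeSpace τ y ∈ (exterior M a : Set E4) :=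
            mem_exterior_of_horizonFn_pos hrp (lt_of_lt_of_le (by positivity) hy.2)
          have := hlow _ hmem
          simp only [hJ0, hWy, one_mul]
          exact this
      _ ≤ ∫⁻ y in closedBall (0 : E3) ρ, ENNReal.ofReal (10 * J0 (E4.ofTimeSpace τ y)) :=
          lintegral_mono_set hSsub
      _ = ENNReal.ofReal (∫ y in closedBall (0 : E3) ρ, 10 * J0 (E4.ofTimeSpace τ y)) :=
          (ofReal_integral_eq_lintegral_ofReal (hJi.const_mul 10)
            (ae_of_all _ fun y ↦ by positivity [hJ0nn (E4.ofTimeSpace τ y)])).symm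
      _ = ENNReal.ofReal (10 * F τ) := by rw [integral_const_mul]
  -- (d) assemble
  have ha : 0 ≤ 10 * F 0 := mul_nonneg (by norm_num) hF0
  have hb : 0 ≤ 10 * Ig := mul_nonneg (by norm_num) hIg0
  have h10le : (0 : ℝ) ≤ 10 := by norm_num
  have h10 : ENNReal.ofReal (10 * F τ) ≤ ENNReal.ofReal 10 * ENNReal.ofReal (F 0) +
      ENNReal.ofReal 10 * ENNReal.ofReal Ig := by
    have h1 : 10 * F τ ≤ 10 * F 0 + 10 * Ig := by linarith
    calc ENNReal.ofReal (10 * F τ) ≤ ENNReal.ofReal (10 * F 0 + 10 * Ig) :=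
          ENNReal.ofReal_le_ofReal h1
      _ = ENNReal.ofReal (10 * F 0) + ENNReal.ofReal (10 * Ig) := ENNReal.ofReal_add ha hb
      _ = ENNReal.ofReal 10 * ENNReal.ofReal (F 0) + ENNReal.ofReal 10 * ENNReal.ofReal Ig := by
          rw [ENNReal.ofReal_mul h10le, ENNReal.ofReal_mul h10le]
  have h750 : ENNReal.ofReal 10 * (ENNReal.ofReal 75 * E0) = ENNReal.ofReal 750 * E0 := by
    rw [← mul_assoc, ← ENNReal.ofReal_mul h10le]
    norm_num
  have h10CK : ENNReal.ofReal 10 * (ENNReal.ofReal CK * IL) = ENNReal.ofReal (10 * CK) * IL := by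
    rw [← mul_assoc, ← ENNReal.ofReal_mul h10le]
  calc ∫⁻ y in Sset, f τ y ≤ ENNReal.ofReal (10 * F τ) := hlowτ
    _ ≤ ENNReal.ofReal 10 * ENNReal.ofReal (F 0) + ENNReal.ofReal 10 * ENNReal.ofReal Ig := h10
    _ ≤ ENNReal.ofReal 10 * (ENNReal.ofReal 75 * E0) + ENNReal.ofReal 10 * (ENNReal.ofReal CK * IL) :=
        add_le_add (mul_le_mul' le_rfl hF0le) (mul_le_mul' le_rfl hIgle)
    _ = ENNReal.ofReal 750 * E0 + ENNReal.ofReal (10 * CK) * IL := by rw [h750, h10CK]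

/-! ### The main estimate -/

set_option maxHeartbeats 400000 in
/-- **Energy boundedness modulo integrated local energy, uniformly on the sub-extremal Kerr family
(coordinate form).** For `M > 0` there is `C = C(M) > 0` such that for every sub-extremal `a`, every
`Φ : ℝ⁴ → ℝ` of class `C²` at the points of the exterior `{r > r₊}` of the ingoing Kerr–Schild chart
which solves the Kerr wave equation `∑_μ ∂_μ (g^{μν} ∂_νΦ) = 0` there, every `ρ₀`, and every
`τ ≥ 0` such that `dΦ` vanishes at the exterior points `x` with `0 ≤ x⁰ ≤ τ`, `‖x⃗‖ > ρ₀`: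
`∫_{{t* = τ}, r > r₊} ∑_μ (∂_μΦ)² dy ≤ C (∫_{{t* = 0}, r > r₊} ∑_μ (∂_μΦ)² dy +
  ∫_{(0, τ]} ∫_{{t* = t}, r > r₊, ‖y‖ ≤ 3M} ∑_μ (∂_μΦ)² dy dt)` in `[0, ∞]`.
This is the first reduction of Dafermos–Rodnianski–Shlapentokh-Rothman, arXiv:1402.7034, §13
("boundedness follows from integrated local energy decay"), i.e. the energy identity of
Dafermos–Rodnianski arXiv:0811.0354, §4.1, §5.2 for a multiplier equal to `T = ∂_{t*}` on
`{‖y‖ ≥ 3M}`; proof in the module docstring (blended current, receding horizon weight, dominant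
energy condition, monotone convergence). [cite: DafermosRodnianski2008, §4.1 and §5.2;
DafermosRodnianskiShlapentokhrothman2014, §13] -/
theorem exterior_coordEnergy_le_local {M : ℝ} (hM : 0 < M) :
    ∃ C : ℝ, 0 < C ∧ ∀ a : ℝ, IsSubextremal M a → ∀ Φ : E4 → ℝ,
      (∀ x ∈ (exterior M a : Set E4), ContDiffAt ℝ 2 Φ x) →
      (∀ x ∈ (exterior M a : Set E4),
        KerrSchild.waveOperator
          (KerrSchild.inverseMetric (fun y ↦ 2 * scalarH M a y) (nullVector a)) Φ x = 0) →
      ∀ (ρ₀ τ : ℝ), 0 ≤ τ →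
      (∀ x ∈ (exterior M a : Set E4), 0 ≤ x 0 → x 0 ≤ τ → ρ₀ < E4.spatialNorm x →
        fderiv ℝ Φ x = 0) →
        (∫⁻ y, {y : E3 | E4.ofTimeSpace τ y ∈ exterior M a}.indicator
            (fun y ↦ ENNReal.ofReal
              (∑ μ, fderiv ℝ Φ (E4.ofTimeSpace τ y) (E4.basisVector μ) ^ 2)) y) ≤
          ENNReal.ofReal C *
            ((∫⁻ y, {y : E3 | E4.ofTimeSpace 0 y ∈ exterior M a}.indicator
              (fun y ↦ ENNReal.ofReal
                (∑ μ, fderiv ℝ Φ (E4.ofTimeSpace 0 y) (E4.basisVector μ) ^ 2)) y) +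
            ∫⁻ t in Ioc (0 : ℝ) τ, ∫⁻ y in closedBall (0 : E3) (3 * M),
              {y : E3 | E4.ofTimeSpace t y ∈ exterior M a}.indicator
                (fun y ↦ ENNReal.ofReal
                  (∑ μ, fderiv ℝ Φ (E4.ofTimeSpace t y) (E4.basisVector μ) ^ 2)) y) := by
  obtain ⟨Cσ, hCσ0, hCσ⟩ := exists_bound_deriv_smoothTransition
  -- ### constants depending on `M` only
  set L : ℝ := Cσ / (M / 4) with hL
  set D : ℝ := (4640 + 80 * Cσ) / M with hD
  have hL0 : 0 ≤ L := by positivity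
  have hD0 : 0 ≤ D := by positivity
  set CK : ℝ := 48 * L * 25 + 32 * 5 * D with hCK
  have hCK0 : 0 ≤ CK := by positivity
  refine ⟨max 750 (10 * CK), lt_max_of_lt_left (by norm_num), ?_⟩
  intro a hMa Φ hΦ2 hsol ρ₀ τ hτ hfar
  have hrp : 0 < rPlus M a := hMa.rPlus_pos
  set B := surgeryBackground M a (rPlus M a) hMa.pos.le hMa.rPlus_pos with hB
  -- the profile bound `Φ_B = 4M/r₊ ≤ 4`
  have hb0 : 0 ≤ B.bound := (B.φ_nonneg 0).trans (B.φ_le 0)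
  have hb4 : B.bound ≤ 4 := by
    show 4 * M / rPlus M a ≤ 4
    rw [div_le_iff₀ hrp]
    have : M ≤ rPlus M a := by
      unfold rPlus; linarith [Real.sqrt_nonneg (M ^ 2 - a ^ 2)]
    linarith
  -- stationarity and the uniform derivative bound
  have hstat : ∀ x α β, fderiv ℝ (fun y ↦ B.inverseMetric y α β) x (E4.basisVector 0) = 0 :=
    fun x α β ↦ fderiv_surgeryBackground_basisVector_zero hMa.pos.le a hrp x α β
  have hDer : ∀ (x : E4) (μ α β : Fin 4),
      |fderiv ℝ (fun z ↦ B.inverseMetric z α β) x (E4.basisVector μ)| ≤ D :=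
    fun x μ α β ↦ abs_fderiv_surgeryBackground_rPlus_le hMa hCσ x μ α β
  -- the equation on the surgered background
  have hsolB : ∀ x ∈ (exterior M a : Set E4), KerrSchild.waveOperator B.inverseMetric Φ x = 0 := by
    intro x hx
    rw [← KerrSchild.waveOperator_congr_of_eventuallyEq
      (surgeryBackground_inverseMetric_eventuallyEq M a hMa.pos.le hMa.rPlus_pos ⟨x, hx⟩) Φ]
    exact hsol x hx
  -- ### the cutoff `χ` and the blended current
  have hχ1 : ContDiff ℝ 1 (fun x : E4 ↦ radialTransition (11 * M / 4) (M / 4) (E4.spatial x)) :=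
    contDiff_farCutoff hM
  have hχ0 : ∀ x : E4, 0 ≤ radialTransition (11 * M / 4) (M / 4) (E4.spatial x) := fun x ↦
    radialTransition_nonneg _ _ _
  have hχle : ∀ x : E4, radialTransition (11 * M / 4) (M / 4) (E4.spatial x) ≤ 1 := fun x ↦
    radialTransition_le_one _ _ _
  have hCK : 48 * L * (1 + B.bound) ^ 2 + 32 * (1 + B.bound) * D ≤ CK := by
    rw [hCK]
    have h1 : (1 + B.bound) ^ 2 ≤ 25 := by nlinarith
    have h2 : 48 * L * (1 + B.bound) ^ 2 ≤ 48 * L * 25 := mul_le_mul_of_nonneg_left h1 (by positivity)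
    have h3 : 32 * (1 + B.bound) * D ≤ 32 * 5 * D := by nlinarith
    linarith
  set E0 : ℝ≥0∞ := ∫⁻ y, {y : E3 | E4.ofTimeSpace 0 y ∈ exterior M a}.indicator
    (fun y ↦ ENNReal.ofReal (∑ μ, fderiv ℝ Φ (E4.ofTimeSpace 0 y) (E4.basisVector μ) ^ 2)) y
    with hE0
  set IL : ℝ≥0∞ := ∫⁻ t in Ioc (0 : ℝ) τ, ∫⁻ y in closedBall (0 : E3) (3 * M),
    {y : E3 | E4.ofTimeSpace t y ∈ exterior M a}.indicator
      (fun y ↦ ENNReal.ofReal (∑ μ, fderiv ℝ Φ (E4.ofTimeSpace t y) (E4.basisVector μ) ^ 2)) y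
    with hIL
  suffices hmain : (∫⁻ y, {y : E3 | E4.ofTimeSpace τ y ∈ exterior M a}.indicator
      (fun y ↦ ENNReal.ofReal (∑ μ, fderiv ℝ Φ (E4.ofTimeSpace τ y) (E4.basisVector μ) ^ 2)) y) ≤
      ENNReal.ofReal 750 * E0 + ENNReal.ofReal (10 * CK) * IL by
    have h1 : ENNReal.ofReal 750 ≤ ENNReal.ofReal (max 750 (10 * CK)) :=
      ENNReal.ofReal_le_ofReal (le_max_left _ _)
    have h2 : ENNReal.ofReal (10 * CK) ≤ ENNReal.ofReal (max 750 (10 * CK)) :=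
      ENNReal.ofReal_le_ofReal (le_max_right _ _)
    calc _ ≤ _ := hmain
      _ ≤ ENNReal.ofReal (max 750 (10 * CK)) * E0 + ENNReal.ofReal (max 750 (10 * CK)) * IL :=
          add_le_add (mul_le_mul' h1 le_rfl) (mul_le_mul' h2 le_rfl)
      _ = ENNReal.ofReal (max 750 (10 * CK)) * (E0 + IL) := (mul_add _ _ _).symm
  -- ### Step 1: the estimate on the saturated sets, by `saturated_lintegral_le`
  have hcore : ∀ R ε : ℝ, 0 < ε → ε ≤ M / 4 * Real.exp (-((2 * M)⁻¹ * τ)) →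
      ∫⁻ y in {y : E3 | ‖y‖ ≤ R ∧ 2 * ε ≤ horizonFn M a (E4.ofTimeSpace τ y)},
          ENNReal.ofReal (∑ μ, fderiv ℝ Φ (E4.ofTimeSpace τ y) (E4.basisVector μ) ^ 2) ≤
        ENNReal.ofReal 750 * E0 + ENNReal.ofReal (10 * CK) * IL := by
    intro R ε hε hεsmall
    refine saturated_lintegral_le hMa (Φ := Φ) (ρ₀ := ρ₀)
      (Cur := fun μ x ↦ radialTransition (11 * M / 4) (M / 4) (E4.spatial x) *
          (-KerrSchild.multiplierCurrent B.inverseMetric KerrSchild.timeField Φ x μ) +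
        (1 - radialTransition (11 * M / 4) (M / 4) (E4.spatial x)) *
          KerrSchild.normalCurrent B.inverseMetric Φ x μ)
      (bulk := fun x ↦ -(∑ μ, fderiv ℝ (fun x : E4 ↦ radialTransition (11 * M / 4) (M / 4)
          (E4.spatial x)) x (E4.basisVector μ) *
            (KerrSchild.multiplierCurrent B.inverseMetric KerrSchild.timeField Φ x μ +
              KerrSchild.normalCurrent B.inverseMetric Φ x μ)) +
        (1 - radialTransition (11 * M / 4) (M / 4) (E4.spatial x)) *
          KerrSchild.deformationTerm B.inverseMetric Φ x)
      (fun μ x hx ↦ B.contDiffAt_blendCurrent hχ1 (hΦ2 x hx) μ) (fun x hx ↦ ?_) (fun x hx ↦ ?_)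
      (fun x hx hr μ ↦ ?_) (fun x hx h0 h1 h2 μ ↦ ?_) hCK0 (fun x hx ↦ ?_) (fun x hx ↦ ?_)
      (fun x hx ↦ ?_) (fun x hx ↦ ?_) hτ hε hεsmall
    · -- divergence (the equation kills the `□Φ` term)
      have h := B.sum_fderiv_blendCurrent hstat hχ1 (hΦ2 x hx)
      rw [hsolB x hx, zero_mul, zero_add] at h
      exact h
    · -- continuity of the bulk at exterior points
      have hw := hΦ2 x hx
      have hT : ∀ μ, ContinuousAt
          (fun y ↦ KerrSchild.multiplierCurrent B.inverseMetric KerrSchild.timeField Φ y μ) x :=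
        fun μ ↦ (B.contDiffAt_timeCurrent hw μ).continuousAt
      have hP : ∀ μ, ContinuousAt (fun y ↦ KerrSchild.normalCurrent B.inverseMetric Φ y μ) x :=
        fun μ ↦ (B.contDiffAt_normalCurrent hw μ).continuousAt
      have hR' : ContinuousAt (KerrSchild.deformationTerm B.inverseMetric Φ) x :=
        (B.contDiffAt_deformationTerm hw).continuousAt
      have hdχ : ∀ μ, ContinuousAt (fun y ↦ fderiv ℝ (fun x : E4 ↦
          radialTransition (11 * M / 4) (M / 4) (E4.spatial x)) y (E4.basisVector μ)) x := fun μ ↦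
        ((hχ1.continuous_fderiv one_ne_zero).clm_apply continuous_const).continuousAt
      have hsum : ContinuousAt (fun y ↦ ∑ μ, fderiv ℝ (fun x : E4 ↦
          radialTransition (11 * M / 4) (M / 4) (E4.spatial x)) y (E4.basisVector μ) *
            (KerrSchild.multiplierCurrent B.inverseMetric KerrSchild.timeField Φ y μ +
              KerrSchild.normalCurrent B.inverseMetric Φ y μ)) x :=
        tendsto_finsetSum _ fun μ _ ↦ (hdχ μ).mul ((hT μ).add (hP μ))
      exact hsum.neg.add ((continuousAt_const.sub hχ1.continuous.continuousAt).mul hR')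
    · -- near the horizon the current is the `dt`-current
      have hχx : radialTransition (11 * M / 4) (M / 4) (E4.spatial x) = 0 := by
        by_contra h
        have := (radius_gt_of_lt_spatialNorm hMa (lt_spatialNorm_of_farCutoff_ne_zero hM h)).2
        linarith
      beta_reduce
      rw [hχx, zero_mul, sub_zero, one_mul, zero_add]
    · -- beyond `ρ₀` on the slab the current vanishes
      have hd : fderiv ℝ Φ x = 0 := hfar x hx h0 h1 h2
      beta_reduce
      rw [KerrSchild.multiplierCurrent_eq_zero_of_fderiv_eq_zero _ _ hd,
        KerrSchild.normalCurrent_eq_zero_of_fderiv_eq_zero _ hd, neg_zero, mul_zero, mul_zero,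
        add_zero]
    · -- the bulk bound
      refine (B.abs_blendBulk_le (χ := fun x : E4 ↦ radialTransition (11 * M / 4) (M / 4)
        (E4.spatial x)) Φ hL0 hD0 (fun μ ↦ abs_fderiv_farCutoff_le hM hCσ x μ) (hχ0 x)
        (hχle x) (hDer x)).trans ?_
      exact mul_le_mul_of_nonneg_right hCK (Finset.sum_nonneg fun _ _ ↦ sq_nonneg _)
    · -- the bulk vanishes beyond `3M`
      have h1 : radialTransition (11 * M / 4) (M / 4) (E4.spatial x) = 1 := farCutoff_eq_one hM hx.le
      have hd := fderiv_farCutoff_eq_zero hM hx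
      beta_reduce
      simp only [hd, h1, zero_apply, zero_mul, Finset.sum_const_zero, neg_zero,
        sub_self, add_zero]
    · -- `Cur⁰ ≤ 75 ∑ (∂Φ)²`
      refine (B.blendCurrent_zero_le (χ := fun x : E4 ↦ radialTransition (11 * M / 4) (M / 4)
        (E4.spatial x)) Φ (hχ0 x) (hχle x)).trans ?_
      refine mul_le_mul_of_nonneg_right ?_ (Finset.sum_nonneg fun _ _ ↦ sq_nonneg _)
      nlinarith
    · -- `∑ (∂Φ)² ≤ 10 Cur⁰`
      exact B.le_blendCurrent_zero (χ := fun x : E4 ↦ radialTransition (11 * M / 4) (M / 4)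
        (E4.spatial x)) Φ (hχ0 x) (hχle x) (fun h ↦ surgeryProfile_le_of_farCutoff_ne_zero hMa hx h)
  -- ### Step 2: exhaust the exterior slice
  set f : E3 → ℝ≥0∞ := fun y ↦
    ENNReal.ofReal (∑ μ, fderiv ℝ Φ (E4.ofTimeSpace τ y) (E4.basisVector μ) ^ 2) with hf
  have hfm : Measurable f := by
    refine ENNReal.measurable_ofReal.comp (Finset.measurable_sum _ fun μ _ ↦ ?_)
    exact ((measurable_fderiv_apply_const ℝ Φ (E4.basisVector μ)).comp
      (E4.continuous_ofTimeSpace τ).measurable).pow_const 2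
  set ε₀ : ℝ := M / 4 * Real.exp (-((2 * M)⁻¹ * τ)) with hε₀
  have hε₀0 : 0 < ε₀ := by positivity
  set εn : ℕ → ℝ := fun n ↦ min (1 / ((n : ℝ) + 1)) ε₀ with hεn
  have hεn0 : ∀ n, 0 < εn n := fun n ↦ lt_min (by positivity) hε₀0
  have hεnle : ∀ n, εn n ≤ ε₀ := fun n ↦ min_le_right _ _
  set Sn : ℕ → Set E3 := fun n ↦
    {y : E3 | ‖y‖ ≤ (n : ℝ) ∧ 2 * εn n ≤ horizonFn M a (E4.ofTimeSpace τ y)} with hSn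
  have hhc : Continuous fun y : E3 ↦ horizonFn M a (E4.ofTimeSpace τ y) :=
    (continuous_horizonFn M a).comp (E4.continuous_ofTimeSpace τ)
  have hSnm : ∀ n, MeasurableSet (Sn n) := fun n ↦
    ((isClosed_le continuous_norm continuous_const).inter
      (isClosed_le continuous_const hhc)).measurableSet
  have hSmono : ∀ {n m : ℕ}, n ≤ m → Sn n ⊆ Sn m := by
    intro n m hnm y hy
    have hcast : (n : ℝ) ≤ m := Nat.cast_le.mpr hnm
    refine ⟨hy.1.trans hcast, le_trans ?_ hy.2⟩
    have h1 : (0 : ℝ) < (n : ℝ) + 1 := by positivity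
    have : εn m ≤ εn n := by
      refine min_le_min ?_ le_rfl
      gcongr
    linarith
  have hUnion : {y : E3 | E4.ofTimeSpace τ y ∈ exterior M a} = ⋃ n, Sn n := by
    ext y
    simp only [mem_setOf_eq, mem_iUnion]
    constructor
    · intro hy
      have hr : rPlus M a < radius a (E4.ofTimeSpace τ y) := lt_radius_of_mem_region hy
      set h : ℝ := horizonFn M a (E4.ofTimeSpace τ y) with hh
      have hpos : 0 < h := mul_pos (sub_pos.mpr hr) (Real.exp_pos _)
      obtain ⟨n, hn⟩ := exists_nat_ge (max ‖y‖ (2 / h))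
      refine ⟨n, (le_max_left _ _).trans hn, ?_⟩
      have h2 : 2 / h ≤ n := (le_max_right _ _).trans hn
      have hn1 : (0 : ℝ) < (n : ℝ) + 1 := by positivity
      rw [div_le_iff₀ hpos] at h2
      have h3 : 2 * (1 / ((n : ℝ) + 1)) ≤ h := by
        rw [mul_one_div, div_le_iff₀ hn1]; nlinarith
      have h4 : εn n ≤ 1 / ((n : ℝ) + 1) := min_le_left _ _
      show 2 * εn n ≤ h
      linarith
    · rintro ⟨n, -, hy⟩
      have hpos : 0 < horizonFn M a (E4.ofTimeSpace τ y) :=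
        lt_of_lt_of_le (by linarith [hεn0 n]) hy
      exact mem_exterior_of_horizonFn_pos hrp hpos
  have hind : ∀ y, {y : E3 | E4.ofTimeSpace τ y ∈ exterior M a}.indicator f y =
      ⨆ n, (Sn n).indicator f y := fun y ↦ by
    rw [hUnion]; exact indicator_iUnion_apply rfl _ _ _
  have hmonof : Monotone fun n ↦ (Sn n).indicator f := fun n m hnm y ↦
    indicator_le_indicator_of_subset (hSmono hnm) (fun _ ↦ zero_le) y
  calc ∫⁻ y, {y : E3 | E4.ofTimeSpace τ y ∈ exterior M a}.indicator f y
      = ∫⁻ y, ⨆ n, (Sn n).indicator f y := lintegral_congr hind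
    _ = ⨆ n, ∫⁻ y, (Sn n).indicator f y := lintegral_iSup (fun n ↦ hfm.indicator (hSnm n)) hmonof
    _ = ⨆ n, ∫⁻ y in Sn n, f y := by
        congr with n
        exact lintegral_indicator (hSnm n) _
    _ ≤ _ := iSup_le fun n ↦ hcore (n : ℝ) (εn n) (hεn0 n) (hεnle n)

end Kerr

end Literature.Geometry.Lorentzian
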